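import Mathlib
import Literature.MathematicalPhysics.QuantumFieldTheory.Balaban1983to89.B16Stage3Regions
import Literature.MathematicalPhysics.QuantumFieldTheory.Balaban1983to89.B15Ineq147Admissible
import Literature.MathematicalPhysics.QuantumFieldTheory.Balaban1983to89.B15LatticeCubeContours
import Literature.MathematicalPhysics.QuantumFieldTheory.Balaban1983to89.B15LatticeCubeTorusNestedBoxes

/-!
# `Balaban1983to89.B15Eq112Admissible` — [Balaban1989LargeFieldI] (1.10)–(1.12) p. 179: the COMPLETION of the new
# large-field regions `Z″_k ⊃ Z″_{k−1} ⊃ … ⊃ Z″_{k−N₀+1}` EXISTS, and **«The sequence {Ω″_j} is an admissible sequence»**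
# — PROVED on the ℤᵈ cube carrier of `B14DomainGeom` / `B14.Eq213MaximalDomains` / `B16Stage3Regions`

statement-level skeleton of published theorems with citation tags; proofs where landed; nothing here is a claim about
the Yang–Mills mass gap.

CITATION HEADER (lean-in-tree rule 2026-08-18).  T. Bałaban, *Large field renormalization. I. The basic step of the 𝐑
operation*, Commun. Math. Phys. **122**, 175–202 (1989), doi:10.1007/BF01257412, bib `Balaban1989LargeFieldI` (cell paper
B15 = [IV]; PDF held `paper:balaban1989-cmp122-large-field-i`, journal page = PDF page + 174; p. 177 = PDF 3, p. 179 =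
PDF 5, read AS IMAGES on the x2 renders `b2b-balaban-ref1/pages/1989-cmp122-large-field-I/…-p003-x2.png`,
`…-p005-x2.png`).  "[III]" = T. Bałaban, *Convergent renormalization expansions for lattice gauge theories*, Commun. Math.
Phys. **119**, 243–285 (1988), doi:10.1007/BF01217741, bib `Balaban1988Convergent` (cell paper B14; p. 256 = PDF 14,
p. 265 = PDF 23, renders `…/1988-cmp119-convergent-renormalization/…-p014-x2.png`, `…-p023-x2.png`).
WHAT IS REPRODUCED: SKELETON row `B15.Eq1.12` (owner r12) — the CLAIM clause *"The sequence {Ω″_j} is an admissible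
sequence"* and the existence clause of (1.10) *"complete these two sets to a sequence … in such a way that"*; cross-reference
rows `B15.Eq1.10`, `B15.Eq1.11` (r12), `B14.Eq2.13` (r11).  Unit `lit-balaban-p29` gen 14 (Phase-2 free target, G.5-34(d)),
HOME `run/shared/lean/pub/lit-balaban/`.  KNITTING — used BY NAME, nothing restated: pv02 `B14DomainGeom.{Pt, Within,
cubeIdx, IsUnionOfCubes, IdxNear, enl, enl_enl, idxNear_of_within, …}`, r11 g4 `B14.Eq213MaximalDomains.{side, side_pos,
side_succ, reach, reach_le, maxDom, seq_subset_maxDom}` (p248052), b02 `B16Stage3Regions.{farZ, Zk, Zk0, OmegaPP,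
isUnionOfCubes_enl, isUnionOfCubes_inter, mem_farZ_iff}`, p29 g8 `B15Ineq147Admissible.ineq147_walk_admissible` +
`B15Ineq147LevelGap.{CubeSite, cube, zoneC, bondC}` (p299858/p301177), r12 `B15.PrelimIntegrations.Ineq147`.

THE PRINTED TEXT ([IV] p. 179 [PDF 5], verbatim).  *"Let us recall that the domains Ω_j^{~n} are unions of L^{−(k−j)}MR_j-cubes
of the lattice T_η. Take the smallest positive integer N₀ such, that L^{−N₀+1}MR_{k−N₀+1} = M. … We assume that N > N₀ …
Define  Z″_k = (Z′_{k−N₀})^{~3} = (Ω^{~5}_{k−N₀+1})ᶜ ∩ Z,  Z″_{k−N₀+1} = (Z′_{k−N₀})^~ = (Ω^{~7}_{k−N₀+1})ᶜ ∩ Z,  (1.10)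
and complete these two sets to a sequence Z″_k, Z″_{k−1}, …, Z″_{k−N₀+2}, Z″_{k−N₀+1} in such a way that the complements of
these sets form an admissible sequence of domains based on partitions into M-cubes in the corresponding scales. Thus Z″_k,
Z″_k∖Z″_{k−1} are unions of M-cubes of the lattice T_η, and Z″ᶜ_k, Z″_{k−1} are separated by one layer of M-cubes.
Similarly, Z″_{k−1}, Z″_{k−1}∖Z″_{k−2} are unions of L⁻¹M-cubes of this lattice, and Z″ᶜ_{k−1}, Z″_{k−2} are separated by one
layer of L⁻¹M-cubes, and so on. Next, define  Z″_j = (Ω_j^{~5})ᶜ ∩ Z for j = k − N₀, k − N₀ − 1, …, k − N + 1 = h + 1,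
Z″_j = Z_j for j = h, h − 1, …, 1.  (1.11)  This is the new sequence of the large field regions. We define new domains Ω″_j
by  Ω″_j = (Z″ᶜ_j ∩ Z) ∪ (Ω_j ∩ Zᶜ) for j = k, k − 1, …, h + 1,  Ω″_j = Ω_j for j = h, h − 1, …, 1.  (1.12)  The sequence
{Ω″_j} is an admissible sequence"*.  [IV] p. 177 [PDF 3]: *"(ii) in the preceding N renormalization steps no new large field
regions were created inside this component"*, *"Let us denote the union of the above class of components by Z"* (Z = a
union of connected components of the large field region Λ_kᶜ).  [III] p. 254 (2.1): *"Ω₁ ⊃ Λ₁ ⊃ Ω₂ ⊃ Λ₂ ⊃ … ⊃ Ω_k ⊃ Λ_k"*;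
p. 256 [PDF 14]: *"a sequence of maximal domains Ω = Ω₀ ⊃ Ω₁ ⊃ … ⊃ Ω_j such that Ω_n is a union of LⁿξM₁-cubes, and
dist(Ω_n, Ωᶜ_{n−1}) ≧ LⁿξM₁, n = 1, …, j"* (the admissibility notion, typed CONCRETELY by r11 as `maxDom` /
`seq_subset_maxDom` in the lattice form used below); p. 265 (3.5) *"Ω_{k+1} = (Q′^{~2}_{k+1} ∪ (B^{k+1}(P¹_{k+1}))ᶜ)^{~3})ᶜ"*
with p. 264 *"Z′_k the union of all LMR_{k+1}-cubes intersecting the region Z_k"*, `B^{k+1}(P¹_{k+1}) = (P′^~_{k+1})ᶜ ∩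
(Z′^{~5}_k)ᶜ` — so the plain one-step rule puts `Ω_{j+1}` at least EIGHT layers of `LMR_{j+1}`-cubes inside `Λ_j ⊂ Ω_j`
(typed by pv02 as `B14DomainGeom.omega35_subset_compl_enl`, consumed in this shape by b02's `B16Stage3Regions` §F).

THE DICTIONARY (= `B15Ineq147Admissible`'s + b02's).  The finest lattice `T_η` of step `k` is `ℤᵈ` (η = 1 lattice unit, the
universal cover of the torus — every statement below is local); the M-cubes *"in the corresponding scale"* `j` have side
`s_j = side L M j = LʲM` lattice units (r11's letter `M₁` of [III] (2.13) is the letter `M` of [IV] p. 179 here), the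
`L^{−(k−j)}MR_j`-cubes of p. 179 have side `s_j·R_j`; `X^{~n}` for a cube family of side `t` is pv02's `enl t n X`.  By the
printed choice of `N₀` the `R`-cubes of the scale `k₀ + 1 := k − N₀ + 1` ARE the M-cubes of the scale `k`
(`hN₀ : side L M (k₀+1) * R (k₀+1) = side L M k`), so (1.10) lives in b02's one-family vocabulary: `Z″_k = Zk s Ω Z`,
`Z″_{k₀+1} = Zk0 s Ω Z` with `s = side L M k`, `Ω = Ω_{k₀+1}`.  ADMISSIBILITY of a sequence `D` up to the scale `k`
(`Admissible L M k D`) is r11's lattice reading of [III] (2.13): `D j` a union of `s_j`-cubes and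
`x ∈ D (j+1) → Within (s_{j+1} − 1) x y → y ∈ D j` (*"dist(Ω_n, Ωᶜ_{n−1}) ≧ LⁿξM₁"*), `j < k`; it implies nesting, r11's
maximality `D j ⊆ maxDom L M (D 0) j`, and (via `B15Ineq147Admissible`) the (1.47) input.

WHAT THIS FILE PROVES (kernel-checked, zero `sorry`, axioms standard; four `Prop`-valued structures = named hypothesis
bundles (`Admissible`, `ClassZ`, `IsCompletion`, `Hypotheses`), five definitions WITH BODIES — `Admissible.extend`, `widen`,
`completion`, `Zpp`, `omegaPP` —, no named fact; §7 inhabits `Hypotheses` with `Z ≠ ∅`).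
§1 toolbox (cube-union algebra, the nearest point of an adjacent cube, the geometric sum `Σ_{j'>j} s_{j'} ≤ 2s_k` via r11's
   `reach_le`).  §2 `Admissible` + API (`antitone`, `extend`, **`subset_maxDom`** = r11's maximality for every admissible
   sequence up to `k`, **`ineq147_walk`** = the (1.47) input of `B15Ineq147Admissible` for it).  §3 `ClassZ` — the located
   reading of p. 177's `Z` (a union of `MR_k`-cube components of `Λ_kᶜ`, `Λ_k ⊂ Ω_k`): `Z` absorbs every point of `Ω_kᶜ`
   cube-adjacent to it; derived from the component form (`ClassZ.of_components`); the two COLLAR LEMMAS (`mem_of_adj`: a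
   point outside `Z` adjacent to `Z` lies in `Ω_k`; `mem_enl_two_of_within`: a point of `Z` within `2s_k − 1` of `Zᶜ` lies in
   `Ω_k^{~2}`).  §4 **THE COMPLETION EXISTS** (`completion`, `isCompletion_completion`): `E_k := Z″ᶜ_k = Ω^{~5} ∪ Zᶜ`,
   `E_j := E_{j+1}` plus ONE layer of `s_{j+1}`-cubes (`k₀+1 < j < k`), `E_{k₀+1} := Z″ᶜ_{k₀+1} = Ω^{~7} ∪ Zᶜ` satisfy the
   printed requirements — every `E_j` a union of `s_j`-cubes, consecutive members separated by one layer — because the total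
   width `Σ_{j=k₀+2}^{k} s_j − 1 ≤ 2s_k − 1` fits into the two layers `Ω^{~7} ∖ Ω^{~5}` (inside `Z` away from `∂Z`) resp. into
   `Ω_k^{~2} ⊂ Ω^{~7}_{k₀+1}` (near `∂Z`, collar lemma); hypotheses: `2 ≤ L`, `1 ≤ M`, `N₀ ≥ 2` (`k₀ + 2 ≤ k`; for N₀ = 1
   the two members of (1.10) would both be `Z″_k`), `ClassZ`, `Ω_k ⊆ Ω_{k₀+1}`.  §5 (1.11)/(1.12) as definitions on this
   carrier (`Zpp`, `omegaPP` — b02's `OmegaPP` display scale by scale) and the riders r12's `B15DeterminingSets` Part G /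
   `detSetN_top` take as hypotheses: `Ω_j ⊆ Ω″_j`, `Z″_j ⊆ Z`, `Z″_j ∩ Ω_j = ∅`, `Z″_j ⊆ Z″_{j+1}` above `h`,
   `Z ∖ Z″_{h+1} ⊆ Ω_h`.  §6 **THE CLAIM**: `admissible_omegaPP` — for ANY completion with the printed properties
   (`IsCompletion`), `{Ω″_j}_{j ≤ k}` is admissible; hypotheses (all located above): `{Ω_j}_{j≤k}` admissible, the (3.5)
   eight-layer margin INSIDE `Z` for the scales `h ≤ j ≤ k₀` (p. 177 (ii): inside the component the last `N` steps followed
   the plain rule), `hN₀`, `ClassZ`, `h < k₀` (*"N > N₀"*), `1 ≤ R_j`; corollaries `admissible_omegaPP_completion` (with the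
   constructed completion: hypothesis-free in `E`), `omegaPP_subset_maxDom`, `ineq147_walk_omegaPP` (the (1.47) input *"by
   the definition of the domains Z″_i"* for THE sequence of (1.12)).  §7 a `d = 1` instance of all hypotheses with `Z ≠ ∅`
   (non-vacuity).  §8 (v1.1) THE KNIT TO [Balaban1984PropagatorsII] LEMMA 2.1: under `Ω₀ = T_η` ([III] (2.2)) the
   sequence `{Ω″_j}` (extended by `∅` above `k`) meets every hypothesis of p29 g12's
   `B15LatticeCubeContours.lemma21_full_latGeo_admissible`, so (2.60)–(2.63) with the d-only `c₁″` hold for the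
   lattice-contour geometry of THE (1.12) domains BY NAME (`Admissible.lemma21_full_latGeo`,
   `Hypotheses.lemma21_full_latGeo_omegaPP`).  §9 (v1.2) THE SAME ON THE TORUS `T_η`: the whole construction commutes
   with the deck translations `x ↦ x + P·v` (`omegaPP_completion_add_pmul`), so for periodic `Ω_j`, `Z` (sets of the
   torus seen on the cover, cube sides dividing the periods) THE (1.12) sequence carries p29 g12/g13's periodicity datum
   (`Hypotheses.isPeriodic_omegaPP`) and the torus Lemma 2.1 — print's (2.46) read literally on `T_η` — holds for it BY
   NAME (`Admissible.lemma21_full_torGeo`, `Hypotheses.lemma21_full_torGeo_omegaPP`; for arbitrary cover data the same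
   for g13's intersected domains, `Admissible.lemma21_full_torGeo_interD`; §9.4 a periodic `d = 1` instance).
HONEST SCOPE.  Set geometry only; nothing analytic.  NOT typed: *"By the definition all components of the domains Z″_j are
also rectangular parallelepipeds"* (needs print's parallelepiped bookkeeping of p. 177/p. 255, cf. b02's note in
`B16Stage3Regions`), the members `Z″_j = Z_j`, `j ≤ h`, of (1.11) (old large-field regions, not needed for (1.12)), the
torus wrap-around beyond §9's deck-invariance (the sets stay on the cover `ℤᵈ`; §9 transfers Lemma 2.1 only).  The (3.5) margin is assumed only INSIDE `Z` and only for the last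
`N₀ + (k₀ − h)` scales — print's p. 177 (ii); outside `Z` only the one-layer admissibility of `{Ω_j}` is used, so earlier
𝐑-operations elsewhere (which reduce margins to one layer, as this very construction does) are covered.  Which completion
print takes is not fixed (*"in such a way that"*): §6 covers every one, §4 exhibits the thinnest.  NOT summit progress.
-/

namespace Literature.MathematicalPhysics.QuantumFieldTheory.Balaban1983to89.B15Eq112Admissible

open Literature.MathematicalPhysics.QuantumFieldTheory.Balaban1983to89
open B14DomainGeom B14.Eq213MaximalDomains B16Stage3Regions B15Ineq147LevelGap

variable {d : ℕ}

/-! ## §1. Toolbox: cube-union algebra, nearest points of adjacent cubes, the geometric sum -/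

/-- A union of `s·t`-cubes is a union of `s`-cubes (nested, compatible partitions: *"This partition is compatible with all
the other partitions"*, [III] p. 265). [folklore] -/
private theorem isUnionOfCubes_of_mul {s t : ℕ} {X : Set (Pt d)} (h : IsUnionOfCubes (s * t) X) : IsUnionOfCubes s X := by
  intro x y hxy
  apply h
  funext i
  have hi := congrFun hxy i
  unfold cubeIdx at hi ⊢
  push_cast
  rw [← Int.ediv_ediv_of_nonneg (Int.natCast_nonneg s), ← Int.ediv_ediv_of_nonneg (Int.natCast_nonneg s), hi]

/-- The same with the side given up to an equation (avoids rewriting inside the set). [folklore] -/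
private theorem isUnionOfCubes_of_eq_mul {s s' t : ℕ} {X : Set (Pt d)} (e : s' = s * t) (h : IsUnionOfCubes s' X) :
    IsUnionOfCubes s X := by
  subst e
  exact isUnionOfCubes_of_mul h

/-- Unions of unions of cubes are unions of cubes. [folklore] -/
private theorem isUnionOfCubes_union {s : ℕ} {X Y : Set (Pt d)} (hX : IsUnionOfCubes s X) (hY : IsUnionOfCubes s Y) :
    IsUnionOfCubes s (X ∪ Y) := fun x y hxy => by
  simp only [Set.mem_union, hX x y hxy, hY x y hxy]

/-- Differences of unions of cubes are unions of cubes. [folklore] -/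
private theorem isUnionOfCubes_diff {s : ℕ} {X Y : Set (Pt d)} (hX : IsUnionOfCubes s X) (hY : IsUnionOfCubes s Y) :
    IsUnionOfCubes s (X \ Y) := fun x y hxy => by
  simp only [Set.mem_sdiff, hX x y hxy, hY x y hxy]

/-- The empty set is a union of cubes. [folklore] -/
private theorem isUnionOfCubes_empty (s : ℕ) : IsUnionOfCubes s (∅ : Set (Pt d)) := fun _ _ _ => by simp

/-- `s_k = s_j · L^{k−j}` for `j ≤ k`: the scale-`k` cubes are unions of scale-`j` cubes. [cite: Balaban1988Convergent, (2.13) p.256] -/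
theorem side_eq_side_mul {L M j k : ℕ} (hjk : j ≤ k) : side L M k = side L M j * L ^ (k - j) := by
  unfold side
  obtain ⟨m, rfl⟩ := Nat.exists_eq_add_of_le hjk
  rw [Nat.add_sub_cancel_left, pow_add]
  ring

/-- A union of `s_k`-cubes (or of `s_k·r`-cubes) is a union of `s_j`-cubes for every `j ≤ k`. [folklore] -/
private theorem isUnionOfCubes_side_of_le {L M j k r : ℕ} (hjk : j ≤ k) {X : Set (Pt d)}
    (h : IsUnionOfCubes (side L M k * r) X) : IsUnionOfCubes (side L M j) X := by
  rw [side_eq_side_mul hjk, mul_assoc] at h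
  exact isUnionOfCubes_of_mul h

/-- Points within sup-distance `s' − 1 ≤ t` (with `s' ≥ 1`, `t ≥ 1`) have adjacent or equal `t`-cubes. [folklore] -/
private theorem idxNear_one_of_within {s' t : ℕ} (ht : 0 < t) (hst : s' ≤ t) {x y : Pt d}
    (h : Within ((s' : ℤ) - 1) x y) : IdxNear t 1 x y :=
  idxNear_of_within t 1 ht (h.mono (by push_cast; omega))

/-- **Nearest point of an adjacent cube.**  If `X` is a union of `s`-cubes and the `s`-cube of `y` is adjacent (or equal) to
a cube meeting `X`, then some point of `X` lies within sup-distance `s` of `y` (clamp `y` into that cube). [folklore] -/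
private theorem exists_within_of_mem_enl_one {s : ℕ} (hs : 0 < s) {X : Set (Pt d)} (hX : IsUnionOfCubes s X) {y : Pt d}
    (hy : y ∈ enl s 1 X) : ∃ x ∈ X, Within (s : ℤ) y x := by
  obtain ⟨z, hz, hn⟩ := hy
  set b := cubeIdx s z with hb
  let x : Pt d := fun i => max ((s : ℤ) * b i) (min (y i) ((s : ℤ) * b i + s - 1))
  have hs' : (0 : ℤ) < s := by exact_mod_cast hs
  have hx_cube : ∀ i, (s : ℤ) * b i ≤ x i ∧ x i < (s : ℤ) * b i + s := by
    intro i
    simp only [x]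
    constructor
    · exact le_max_left _ _
    · rcases le_total ((s : ℤ) * b i) (min (y i) ((s : ℤ) * b i + s - 1)) with hle | hle
      · rw [max_eq_right hle]; have := min_le_right (y i) ((s : ℤ) * b i + s - 1); linarith
      · rw [max_eq_left hle]; linarith
  have hidx : cubeIdx s x = b := cubeIdx_eq_of_mem s hs x b hx_cube
  refine ⟨x, (hX x z (by rw [hidx])).mpr hz, fun i => ?_⟩
  have h1 := cubeIdx_le s hs y i
  have h2 := lt_cubeIdx s hs y i
  have hni := hn i
  push_cast at hni
  obtain ⟨hlo, hhi⟩ := abs_le.mp hni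
  have hlo' : (s : ℤ) * (b i - 1) ≤ (s : ℤ) * cubeIdx s y i := mul_le_mul_of_nonneg_left (by linarith) hs'.le
  have hhi' : (s : ℤ) * cubeIdx s y i ≤ (s : ℤ) * (b i + 1) := mul_le_mul_of_nonneg_left (by linarith) hs'.le
  have hylo : (s : ℤ) * b i - s ≤ y i := by linarith
  have hyhi : y i ≤ (s : ℤ) * b i + 2 * s - 1 := by linarith
  simp only [x]
  rw [abs_le]
  rcases le_total (y i) ((s : ℤ) * b i + s - 1) with hy1 | hy1
  · rw [min_eq_left hy1]
    rcases le_total ((s : ℤ) * b i) (y i) with hy2 | hy2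
    · rw [max_eq_right hy2]; constructor <;> linarith
    · rw [max_eq_left hy2]; constructor <;> linarith
  · rw [min_eq_right hy1, max_eq_right (by linarith)]
    constructor <;> linarith

/-- The midpoint of two lattice points within `2s − 1` of each other is within `s` of both. [folklore] -/
private theorem midpoint_within {s : ℕ} {x y : Pt d} (h : Within (2 * (s : ℤ) - 1) x y) :
    Within (s : ℤ) (fun i => (x i + y i) / 2) x ∧ Within (s : ℤ) (fun i => (x i + y i) / 2) y := by
  constructor
  · intro i
    have := abs_le.mp (h i)
    dsimp only
    rw [abs_le]; constructor <;> omega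
  · intro i
    have := abs_le.mp (h i)
    dsimp only
    rw [abs_le]; constructor <;> omega

/-- `reach k = s_k + s_{k−1} + … + s_1` dominates every tail sum: for `m ≤ k`,
`(Σ_{i<m} s_{k−i}) + reach (k − m) = reach k`. [cite: Balaban1988Convergent, (2.13) p.256] -/
theorem tail_add_reach (L M k : ℕ) : ∀ m ≤ k,
    (Finset.range m).sum (fun i => side L M (k - i)) + reach L M (k - m) = reach L M k := by
  intro m
  induction m with
  | zero => intro _; simp
  | succ m ih =>
    intro hm
    have hm' : m ≤ k := Nat.le_of_succ_le hm
    have e : k - m = (k - (m + 1)) + 1 := by omega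
    have hr : reach L M (k - m) = side L M (k - m) + reach L M (k - (m + 1)) := by
      conv_lhs => rw [e]
      simp only [reach]
      rw [← e]
    rw [Finset.sum_range_succ, ← ih hm', hr]
    ring

/-- Hence the total width of the completion, `Σ_{j=k₀+2}^{k} s_j`, is at most `2s_k` for `L ≥ 2` (r11's `reach_le`).
[cite: Balaban1988Convergent, (2.13) p.256] -/
theorem tail_le_two_side {L : ℕ} (hL : 2 ≤ L) (M k : ℕ) {m : ℕ} (hm : m ≤ k) :
    (Finset.range m).sum (fun i => side L M (k - i)) ≤ 2 * side L M k := by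
  have h := tail_add_reach L M k m hm
  have h2 := reach_le hL M k
  omega

/-! ## §2. Admissible sequences up to a scale ([III] (2.13), r11's lattice form) -/

/-- **[III] (2.13)-admissibility of `{D_j}_{j ≤ k}` based on partitions into M-cubes in the corresponding scales** (r11's
lattice reading, `B14.Eq213MaximalDomains.seq_subset_maxDom`): `D_j` is a union of `LʲM`-cubes (`j ≤ k`), and
*"dist(Ω_n, Ωᶜ_{n−1}) ≧ LⁿξM₁"* — every lattice point within sup-distance `< s_{j+1}` of `D_{j+1}` lies in `D_j`
(`j < k`); [IV] p. 179: *"separated by one layer of M-cubes … in the corresponding scales"*.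
[cite: Balaban1988Convergent, (2.13) p.256; Balaban1989LargeFieldI, (1.10) p.179] -/
structure Admissible (L M k : ℕ) (D : ℕ → Set (Pt d)) : Prop where
  cubes : ∀ j, j ≤ k → IsUnionOfCubes (side L M j) (D j)
  sep : ∀ j, j < k → ∀ x ∈ D (j + 1), ∀ y, Within ((side L M (j + 1) : ℤ) - 1) x y → y ∈ D j

namespace Admissible

variable {L M k : ℕ} {D : ℕ → Set (Pt d)}

/-- Admissible sequences are nested: `D_{j+1} ⊆ D_j` (`j < k`). [cite: Balaban1988Convergent, (2.13) p.256] -/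
theorem subset_succ (hA : Admissible L M k D) (hL : 1 ≤ L) (hM : 1 ≤ M) {j : ℕ} (hj : j < k) : D (j + 1) ⊆ D j :=
  fun x hx => hA.sep j hj x hx x (Within.refl (by have := side_pos hL hM (j + 1); omega) x)

/-- … hence `D_{j'} ⊆ D_j` for `j ≤ j' ≤ k` (*"Ω₁ ⊃ Ω₂ ⊃ … ⊃ Ω_k"*). [cite: Balaban1988Convergent, (2.1) p.254] -/
theorem antitone (hA : Admissible L M k D) (hL : 1 ≤ L) (hM : 1 ≤ M) {j j' : ℕ} (hjj' : j ≤ j') (hj' : j' ≤ k) :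
    D j' ⊆ D j := by
  induction hjj' with
  | refl => exact le_rfl
  | @step m hm ih => exact (hA.subset_succ hL hM (by omega)).trans (ih (by omega))

/-- The sequence extended by `∅` above the scale `k` (to feed the `∀ n` forms of r11 and of `B15Ineq147Admissible`).
[folklore] -/
def extend (k : ℕ) (D : ℕ → Set (Pt d)) (n : ℕ) : Set (Pt d) := if n ≤ k then D n else ∅

/-- Below `k` the extension is the sequence. [folklore] -/
private theorem extend_of_le {n : ℕ} (hn : n ≤ k) : extend k D n = D n := by simp [extend, hn]

/-- Above `k` the extension is empty. [folklore] -/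
private theorem extend_of_lt {n : ℕ} (hn : k < n) : extend k D n = ∅ := by
  have : ¬ n ≤ k := by omega
  simp [extend, this]

/-- The extension has unions of cubes at every scale `≥ 1`. [cite: Balaban1988Convergent, (2.13) p.256] -/
theorem extend_cubes (hA : Admissible L M k D) (n : ℕ) : IsUnionOfCubes (side L M (n + 1)) (extend k D (n + 1)) := by
  by_cases hn : n + 1 ≤ k
  · rw [extend_of_le hn]; exact hA.cubes (n + 1) hn
  · rw [extend_of_lt (by omega)]; exact isUnionOfCubes_empty _

/-- The extension satisfies the separation at every scale. [cite: Balaban1988Convergent, (2.13) p.256] -/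
theorem extend_sep (hA : Admissible L M k D) : ∀ n, ∀ x ∈ extend k D (n + 1), ∀ y,
    Within ((side L M (n + 1) : ℤ) - 1) x y → y ∈ extend k D n := by
  intro n x hx y hy
  by_cases hn : n + 1 ≤ k
  · rw [extend_of_le hn] at hx
    rw [extend_of_le (by omega)]
    exact hA.sep n (by omega) x hx y hy
  · rw [extend_of_lt (by omega)] at hx
    exact absurd hx (Set.notMem_empty x)

/-- **r11's MAXIMALITY for every admissible sequence**: `D_j ⊆ maxDom L M (D 0) j` for `j ≤ k` — an admissible sequence lies
termwise inside the maximal one generated by its finest member ([III] p. 256 *"a sequence of maximal domains"*).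
[cite: Balaban1988Convergent, (2.13) p.256] -/
theorem subset_maxDom (hA : Admissible L M k D) {j : ℕ} (hj : j ≤ k) : D j ⊆ maxDom L M (D 0) j := by
  have h := seq_subset_maxDom L M (D 0) (extend k D) (by rw [extend_of_le (Nat.zero_le k)])
    hA.extend_cubes hA.extend_sep j
  rwa [extend_of_le hj] at h

/-- **The (1.47) input for every admissible sequence up to `k`** (`B15Ineq147Admissible.ineq147_walk_admissible` BY NAME on the
extension): on the bond-cube graph built on the large-field regions `Z″_n = (D_n)ᶜ` (∅ᶜ above `k`), every admissible contour
from a bond cube of scale `≤ i` to one meeting `D_{j+1}`, `j < k`, has length `≥ (M/M₁)(j − i)`, in r12's shape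
`B15.PrelimIntegrations.Ineq147`. [cite: Balaban1989LargeFieldI, (1.47) p.186; Balaban1988Convergent, (2.13) p.256] -/
theorem ineq147_walk (hA : Admissible L M k D) {M₁ : ℕ} (hM₁ : 0 < M₁) (hdvd : M₁ ∣ M) (hM : 0 < M) (hL : 2 ≤ L)
    {i j : ℕ} (hj : j < k) {s t : CubeSite M₁ L (fun n => (extend k D n)ᶜ)}
    (p : (bondC M₁ L (fun n => (extend k D n)ᶜ)).Walk s t) (hs : zoneC s ≤ i)
    (ht : ∃ x ∈ cube M₁ L t.1.1 t.1.2, x ∈ D (j + 1)) {δ : ℝ} (hδ : 0 ≤ δ) :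
    B15.PrelimIntegrations.Ineq147 δ (p.length : ℝ) M M₁ ((j - i : ℕ) : ℝ) := by
  refine B15Ineq147Admissible.ineq147_walk_admissible hA.extend_sep hM₁ hdvd hM hL p hs ?_ hδ
  rw [extend_of_le (by omega)]
  exact ht

end Admissible

/-! ## §3. The class `Z` of p. 177 and its collar -/

/-- **The located reading of p. 177's `Z`** relative to the top domain `Ω_k` and the `MR_k`-cubes (side `u = s_k·R_k`):
`Z` is a union of such cubes, and `Z` ABSORBS every point of `Ω_kᶜ` whose cube is adjacent (corners included) to a cube of
`Z` — the trace on `Ω_k` of *"Let us denote the union of the above class of components [of the large field region Λ_kᶜ] by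
Z"* together with [III] (2.1) `Λ_k ⊂ Ω_k` (`of_components`).  Print's `Z ⊂ Λ_kᶜ` is not needed below.
[cite: Balaban1989LargeFieldI, p.177; Balaban1988Convergent, (2.1) p.254] -/
structure ClassZ (u : ℕ) (Z Ωk : Set (Pt d)) : Prop where
  cubes : IsUnionOfCubes u Z
  closed : ∀ ⦃x y : Pt d⦄, y ∈ Z → x ∉ Ωk → IdxNear u 1 x y → x ∈ Z

namespace ClassZ

variable {u : ℕ} {Z Ωk : Set (Pt d)}

/-- From the printed form: `Z` a union of `u`-cubes closed under cube-adjacency inside `Λ_kᶜ` (a union of connected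
components of `Λ_kᶜ` for the adjacency "cubes at index distance ≤ 1"), and `Λ_k ⊆ Ω_k`.
[cite: Balaban1989LargeFieldI, p.177; Balaban1988Convergent, (2.1) p.254] -/
theorem of_components {Λk : Set (Pt d)} (hcubes : IsUnionOfCubes u Z) (hΛΩ : Λk ⊆ Ωk)
    (hcomp : ∀ ⦃x y : Pt d⦄, y ∈ Z → x ∉ Λk → IdxNear u 1 x y → x ∈ Z) : ClassZ u Z Ωk :=
  ⟨hcubes, fun _ _ hy hx hn => hcomp hy (fun h => hx (hΛΩ h)) hn⟩

/-- **Collar lemma, outside**: a point outside `Z` whose `u`-cube is adjacent to a cube of `Z` lies in `Ω_k` (it lies in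
`Λ_k`: otherwise it would belong to the same component). [cite: Balaban1989LargeFieldI, p.177] -/
theorem mem_of_adj (hZ : ClassZ u Z Ωk) {x y : Pt d} (hy : y ∈ Z) (hx : x ∉ Z) (hn : IdxNear u 1 x y) : x ∈ Ωk := by
  by_contra h
  exact hx (hZ.closed hy h hn)

/-- **Collar lemma, inside**: a point of `Z` within sup-distance `2s − 1` of a point outside `Z` (`1 ≤ s ≤ u`) lies in
`Ω_k^{~2}` for the `s`-cubes — indeed within two `s`-cubes of a point of `Ω_k` (midpoint argument: the midpoint is adjacent,
in `u`-cubes, to both; either it lies in `Ω_k`, or it is absorbed by `Z` and then the outside point lies in `Ω_k`).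
[cite: Balaban1989LargeFieldI, p.177] -/
theorem mem_enl_two_of_within (hZ : ClassZ u Z Ωk) {s : ℕ} (hs : 0 < s) (hsu : s ≤ u) {x y : Pt d} (hy : y ∈ Z)
    (hx : x ∉ Z) (hw : Within (2 * (s : ℤ) - 1) y x) : y ∈ enl s 2 Ωk := by
  have hu : 0 < u := lt_of_lt_of_le hs hsu
  obtain ⟨hmy, hmx⟩ := midpoint_within hw
  set m : Pt d := fun i => (y i + x i) / 2 with hm
  have hsu' : (s : ℤ) ≤ (1 : ℕ) * (u : ℤ) := by push_cast; omega
  have hmy_u : IdxNear u 1 m y := idxNear_of_within u 1 hu (hmy.mono hsu')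
  have hmx_u : IdxNear u 1 m x := idxNear_of_within u 1 hu (hmx.mono hsu')
  by_cases hmΩ : m ∈ Ωk
  · refine ⟨m, hmΩ, ?_⟩
    have h1 : IdxNear s 1 y m := (idxNear_of_within s 1 hs (hmy.mono (by push_cast; omega))).symm
    exact fun i => (h1 i).trans (by norm_num)
  · have hmZ : m ∈ Z := hZ.closed hy hmΩ hmy_u
    have hxΩ : x ∈ Ωk := hZ.mem_of_adj hmZ hx hmx_u.symm
    exact ⟨x, hxΩ, idxNear_of_within s 2 hs (hw.mono (by push_cast; omega))⟩

end ClassZ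

/-! ## §4. (1.10): the completion EXISTS -/

section Completion

variable (L M k : ℕ)

/-- Widening a set by one layer of `s_k`-cubes, then one layer of `s_{k−1}`-cubes, …: `widen X m` = `X` plus layers of the
scales `k, k−1, …, k−m+1` (the members `Z″ᶜ_{k−m}` of the completion of (1.10), counted from the top).
[cite: Balaban1989LargeFieldI, (1.10) p.179] -/
def widen (X : Set (Pt d)) : ℕ → Set (Pt d)
  | 0 => X
  | m + 1 => enl (side L M (k - m)) 1 (widen X m)

variable {L M k}

/-- `widen X m` is a union of `s_{k−m}`-cubes if `X` is a union of `s_k`-cubes (`m ≤ k`). [cite: Balaban1989LargeFieldI, (1.10) p.179] -/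
theorem isUnionOfCubes_widen {X : Set (Pt d)} (hX : IsUnionOfCubes (side L M k) X) :
    ∀ m ≤ k, IsUnionOfCubes (side L M (k - m)) (widen L M k X m) := by
  intro m
  induction m with
  | zero => intro _; simpa [widen] using hX
  | succ m _ =>
    intro hm
    have h1 : IsUnionOfCubes (side L M (k - m)) (widen L M k X (m + 1)) := isUnionOfCubes_enl _ 1 _
    have e : side L M (k - m) = side L M (k - (m + 1)) * L := by
      rw [show k - m = (k - (m + 1)) + 1 by omega, side_succ]; ring
    exact isUnionOfCubes_of_eq_mul e h1

/-- **Width of the widening**: every point of `widen X m` (`m ≤ k`) is within sup-distance `Σ_{i<m} s_{k−i}` of a point of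
`X` (each layer of `s`-cubes around a union of `s`-cubes adds exactly `s`, `exists_within_of_mem_enl_one`).
[cite: Balaban1989LargeFieldI, (1.10) p.179] -/
theorem exists_within_of_mem_widen (hL : 1 ≤ L) (hM : 1 ≤ M) {X : Set (Pt d)} (hX : IsUnionOfCubes (side L M k) X) :
    ∀ m ≤ k, ∀ y ∈ widen L M k X m, ∃ x ∈ X,
      Within (((Finset.range m).sum (fun i => side L M (k - i)) : ℕ) : ℤ) y x := by
  intro m
  induction m with
  | zero => intro _ y hy; exact ⟨y, by simpa [widen] using hy, Within.refl (by simp) y⟩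
  | succ m ih =>
    intro hm y hy
    have hm' : m ≤ k := Nat.le_of_succ_le hm
    change y ∈ enl (side L M (k - m)) 1 (widen L M k X m) at hy
    obtain ⟨x₁, hx₁, hw₁⟩ :=
      exists_within_of_mem_enl_one (side_pos hL hM (k - m)) (isUnionOfCubes_widen hX m hm') hy
    obtain ⟨x₀, hx₀, hw₀⟩ := ih hm' x₁ hx₁
    refine ⟨x₀, hx₀, ?_⟩
    have h := hw₁.triangle hw₀
    rw [Finset.sum_range_succ]
    push_cast at h ⊢
    exact h.mono (by linarith)

variable (L M) (k₀ k : ℕ)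

/-- **THE COMPLETION of (1.10)**, as the sequence of DOMAINS `E_j = Z″ᶜ_j`, `k₀ + 1 ≤ j ≤ k` (`k₀ = k − N₀`, `Ω = Ω_{k₀+1}`,
`s = s_k` the M-cubes of the top scale = the `R`-cubes of the scale `k₀+1`): `E_k = Z″ᶜ_k = Ω^{~5} ∪ Zᶜ`, then downwards one
layer of `s_{j+1}`-cubes per scale, `E_j = (E_{j+1})^{~1}`, and the printed bottom member `E_{k₀+1} = Z″ᶜ_{k₀+1} = Ω^{~7} ∪ Zᶜ`
(values at `j ≤ k₀` are not used; above `k` it is `E_k`).  The thinnest choice print's *"in such a way that"* allows.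
[cite: Balaban1989LargeFieldI, (1.10) p.179] -/
def completion (Ω Z : Set (Pt d)) (j : ℕ) : Set (Pt d) :=
  if j ≤ k₀ + 1 then (Zk0 (side L M k) Ω Z)ᶜ else widen L M k (Zk (side L M k) Ω Z)ᶜ (k - j)

/-- **What print requires of a completion** (`E_j = Z″ᶜ_j`): the two members of (1.10) at the ends, *"the complements of
these sets form an admissible sequence of domains based on partitions into M-cubes in the corresponding scales"* in between
— unions of `s_j`-cubes, consecutive members separated by one layer. [cite: Balaban1989LargeFieldI, (1.10) p.179] -/
structure IsCompletion (Ω Z : Set (Pt d)) (E : ℕ → Set (Pt d)) : Prop where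
  top : E k = (Zk (side L M k) Ω Z)ᶜ
  bot : E (k₀ + 1) = (Zk0 (side L M k) Ω Z)ᶜ
  cubes : ∀ j, k₀ + 1 ≤ j → j ≤ k → IsUnionOfCubes (side L M j) (E j)
  sep : ∀ j, k₀ + 1 ≤ j → j < k → ∀ x ∈ E (j + 1), ∀ y, Within ((side L M (j + 1) : ℤ) - 1) x y → y ∈ E j

variable {L M k₀ k}

namespace IsCompletion

variable {Ω Z : Set (Pt d)} {E : ℕ → Set (Pt d)}

/-- A completion is nested: `E_{j+1} ⊆ E_j`, i.e. `Z″_j ⊆ Z″_{j+1}` (*"Z″_k, Z″_k∖Z″_{k−1} …"*). [cite: Balaban1989LargeFieldI, (1.10) p.179] -/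
theorem subset_succ (hE : IsCompletion L M k₀ k Ω Z E) (hL : 1 ≤ L) (hM : 1 ≤ M) {j : ℕ} (hj : k₀ + 1 ≤ j) (hjk : j < k) :
    E (j + 1) ⊆ E j :=
  fun x hx => hE.sep j hj hjk x hx x (Within.refl (by have := side_pos hL hM (j + 1); omega) x)

/-- … hence `E_k ⊆ E_j` (`Z″_j ⊆ Z″_k`) for `k₀ + 1 ≤ j ≤ k`. [cite: Balaban1989LargeFieldI, (1.10) p.179] -/
theorem top_subset (hE : IsCompletion L M k₀ k Ω Z E) (hL : 1 ≤ L) (hM : 1 ≤ M) {j : ℕ} (hj : k₀ + 1 ≤ j) (hjk : j ≤ k) :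
    E k ⊆ E j := by
  have key : ∀ n j', k₀ + 1 ≤ j' → j' + n = k → E k ⊆ E j' := by
    intro n
    induction n with
    | zero => intro j' _ h; rw [Nat.add_zero] at h; rw [h]
    | succ n ih =>
      intro j' hj' h
      exact (ih (j' + 1) (by omega) (by omega)).trans (hE.subset_succ hL hM hj' (by omega))
  exact key (k - j) j hj (by omega)

/-- Every member contains `Zᶜ` and `Ω^{~5}` (so `Z″_j ⊆ Z ∖ Ω^{~5} = Z″_k`). [cite: Balaban1989LargeFieldI, (1.10) p.179] -/
theorem enl_union_compl_subset (hE : IsCompletion L M k₀ k Ω Z E) (hL : 1 ≤ L) (hM : 1 ≤ M) {j : ℕ} (hj : k₀ + 1 ≤ j)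
    (hjk : j ≤ k) : enl (side L M k) 5 Ω ∪ Zᶜ ⊆ E j := by
  refine Set.Subset.trans ?_ (hE.top_subset hL hM hj hjk)
  rw [hE.top]
  intro x hx hxZ
  rcases hx with hx | hx
  · exact hxZ.1 hx
  · exact hx hxZ.2

end IsCompletion

/-- The top member of the construction is the printed `Z″ᶜ_k`. [cite: Balaban1989LargeFieldI, (1.10) p.179] -/
theorem completion_top (hk : k₀ + 1 < k) (Ω Z : Set (Pt d)) :
    completion L M k₀ k Ω Z k = (Zk (side L M k) Ω Z)ᶜ := by
  have : ¬ k ≤ k₀ + 1 := by omega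
  simp [completion, this, widen]

/-- The bottom member is the printed `Z″ᶜ_{k₀+1}`. [cite: Balaban1989LargeFieldI, (1.10) p.179] -/
theorem completion_bot (Ω Z : Set (Pt d)) : completion L M k₀ k Ω Z (k₀ + 1) = (Zk0 (side L M k) Ω Z)ᶜ := by
  simp [completion]

/-- In between, each member is the next one up plus one layer of `s_{j+1}`-cubes (*"separated by one layer of M-cubes …
L⁻¹M-cubes … and so on"*). [cite: Balaban1989LargeFieldI, (1.10) p.179] -/
theorem completion_mid {j : ℕ} (hj : k₀ + 1 < j) (hjk : j < k) (Ω Z : Set (Pt d)) :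
    completion L M k₀ k Ω Z j = enl (side L M (j + 1)) 1 (completion L M k₀ k Ω Z (j + 1)) := by
  have h1 : ¬ j ≤ k₀ + 1 := by omega
  have h2 : ¬ j + 1 ≤ k₀ + 1 := by omega
  simp only [completion, h1, h2, if_false]
  rw [show k - j = (k - (j + 1)) + 1 by omega]
  simp only [widen]
  rw [show k - (k - (j + 1)) = j + 1 by omega]

/-- `Z″ᶜ_k = Ω^{~5} ∪ Zᶜ` and `Z″ᶜ_{k₀+1} = Ω^{~7} ∪ Zᶜ` are unions of `s_k`-cubes when `Z` is a union of `s_k·r`-cubes.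
[cite: Balaban1989LargeFieldI, (1.10) p.179] -/
theorem isUnionOfCubes_compl_farZ {s r : ℕ} (n : ℕ) (Ω : Set (Pt d)) {Z : Set (Pt d)} (hZ : IsUnionOfCubes (s * r) Z) :
    IsUnionOfCubes s (farZ s n Ω Z)ᶜ :=
  (isUnionOfCubes_inter (isUnionOfCubes_enl s n Ω).compl (isUnionOfCubes_of_mul hZ)).compl

/-- **(1.10): THE COMPLETION EXISTS.**  For `L ≥ 2`, `M ≥ 1`, `N₀ ≥ 2` (`k₀ + 2 ≤ k`), `Z` of the class of p. 177 for the
`s_k·R_k`-cubes relative to `Ω_k` (`ClassZ`, `1 ≤ R_k`) and `Ω_k ⊆ Ω = Ω_{k₀+1}`, the constructed `completion` has the printed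
end members and is admissible in between.  The one non-trivial point is the LAST separation `E_{k₀+2} → E_{k₀+1} = Ω^{~7} ∪ Zᶜ`:
a point within `s_{k₀+2} − 1` of `E_{k₀+2}` is within `Σ_{j=k₀+2}^{k} s_j − 1 ≤ 2s_k − 1` of `E_k = Ω^{~5} ∪ Zᶜ`
(`tail_le_two_side`), hence inside the two extra layers `Ω^{~7}` — or, near `∂Z`, inside `Ω_k^{~2} ⊆ Ω^{~2}` by the collar
lemma. [cite: Balaban1989LargeFieldI, (1.10) p.179] -/
theorem isCompletion_completion (hL : 2 ≤ L) (hM : 1 ≤ M) (hk : k₀ + 2 ≤ k) {R : ℕ} (hR : 1 ≤ R)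
    {Ω Ωk Z : Set (Pt d)} (hZ : ClassZ (side L M k * R) Z Ωk) (hΩk : Ωk ⊆ Ω) :
    IsCompletion L M k₀ k Ω Z (completion L M k₀ k Ω Z) := by
  have hL1 : 1 ≤ L := le_trans (by norm_num) hL
  have hs : 0 < side L M k := side_pos hL1 hM k
  set s := side L M k with hs_def
  -- the top member is a union of `s_k`-cubes
  have htopc : IsUnionOfCubes s (Zk s Ω Z)ᶜ := isUnionOfCubes_compl_farZ 5 Ω hZ.cubes
  refine ⟨completion_top (by omega) Ω Z, completion_bot Ω Z, ?_, ?_⟩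
  · -- cubes
    intro j hj hjk
    rcases Nat.lt_or_ge (k₀ + 1) j with hlt | hle
    · rcases Nat.lt_or_ge j k with hjk' | hjk'
      · rw [completion_mid hlt hjk']
        have h1 : IsUnionOfCubes (side L M (j + 1)) (enl (side L M (j + 1)) 1 (completion L M k₀ k Ω Z (j + 1))) :=
          isUnionOfCubes_enl _ 1 _
        exact isUnionOfCubes_of_eq_mul (by rw [side_succ, mul_comm]) h1
      · have hjk2 : j = k := le_antisymm hjk hjk'
        subst hjk2
        rw [completion_top (by omega)]
        exact htopc
    · have hj' : j = k₀ + 1 := le_antisymm hle hj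
      subst hj'
      rw [completion_bot]
      have h7 : IsUnionOfCubes s (Zk0 s Ω Z)ᶜ := isUnionOfCubes_compl_farZ 7 Ω hZ.cubes
      exact isUnionOfCubes_of_eq_mul (by rw [hs_def, side_eq_side_mul hjk]) h7
  · -- separation
    intro j hj hjk x hx y hy
    rcases Nat.lt_or_ge (k₀ + 1) j with hlt | hle
    · -- in between: by construction
      rw [completion_mid hlt hjk]
      exact ⟨x, hx, (idxNear_one_of_within (side_pos hL1 hM (j + 1)) le_rfl hy).symm⟩
    · -- the last step `E_{k₀+2} → E_{k₀+1}`
      have hj' : j = k₀ + 1 := le_antisymm hle hj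
      subst hj'
      rw [completion_bot]
      have hx' : x ∈ widen L M k (Zk s Ω Z)ᶜ (k - (k₀ + 2)) := by
        have h1 : ¬ k₀ + 1 + 1 ≤ k₀ + 1 := by omega
        simpa [completion, h1] using hx
      obtain ⟨x₀, hx₀, hw₀⟩ := exists_within_of_mem_widen hL1 hM htopc (k - (k₀ + 2)) (by omega) x hx'
      -- total width ≤ 2 s_k − 1
      have hwidth : ((Finset.range (k - (k₀ + 2))).sum (fun i => side L M (k - i)) : ℤ) + side L M (k₀ + 2)
          ≤ 2 * (s : ℤ) := by
        have h := tail_le_two_side hL M k (m := k - (k₀ + 2) + 1) (by omega)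
        rw [Finset.sum_range_succ, show k - (k - (k₀ + 2)) = k₀ + 2 by omega] at h
        exact_mod_cast h
      have hyx₀ : Within (2 * (s : ℤ) - 1) y x₀ := by
        have hy' : Within ((side L M (k₀ + 2) : ℤ) - 1) x y := hy
        have h := (hy'.symm).triangle hw₀
        push_cast at h hwidth
        exact h.mono (by linarith)
      -- conclude: `y ∈ Ω^{~7} ∪ Zᶜ`
      intro hy7
      have hy7' : y ∈ farZ s 7 Ω Z := hy7
      rw [mem_farZ_iff] at hy7'
      obtain ⟨hyZ, hyfar⟩ := hy7'
      have hy2 : IdxNear s 2 y x₀ := idxNear_of_within s 2 hs (hyx₀.mono (by push_cast; linarith))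
      rcases (show x₀ ∈ enl s 5 Ω ∨ x₀ ∉ Z by
          by_contra hc; push Not at hc; exact hx₀ ⟨hc.1, hc.2⟩) with hx₀5 | hx₀Z
      · obtain ⟨z, hz, hn⟩ := hx₀5
        exact hyfar z hz (fun i => by have := (IdxNear.triangle hy2 hn) i; simpa using this)
      · -- near `∂Z`: collar lemma
        have hsu : s ≤ s * R := Nat.le_mul_of_pos_right s hR
        have hy2Ω : y ∈ enl s 2 Ωk := hZ.mem_enl_two_of_within hs hsu hyZ hx₀Z hyx₀
        obtain ⟨z, hz, hn⟩ := hy2Ω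
        exact hyfar z (hΩk hz) (fun i => (hn i).trans (by norm_num))

end Completion

/-! ## §5. (1.11)/(1.12) on the cube carrier, and the riders -/

section NewSequence

variable (L M h k₀ : ℕ) (R : ℕ → ℕ) (Ω E : ℕ → Set (Pt d)) (Z : Set (Pt d))

/-- **(1.11) above `h`**: `Z″_j = (Ω_j^{~5})ᶜ ∩ Z` for `h < j ≤ k₀` (`~` for the `L^{−(k−j)}MR_j`-cubes, side `s_j·R_j`;
b02's `farZ`), and `Z″_j = E_jᶜ` — the completion of (1.10) — for `j > k₀` (the printed members `Z″_j = Z_j`, `j ≤ h`, are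
the old large-field regions and play no role in (1.12); the value of this function at `j ≤ h` is not print's).
[cite: Balaban1989LargeFieldI, (1.11) p.179] -/
def Zpp (j : ℕ) : Set (Pt d) := if j ≤ k₀ then farZ (side L M j * R j) 5 (Ω j) Z else (E j)ᶜ

/-- **(1.12)**, verbatim: *"Ω″_j = (Z″ᶜ_j ∩ Z) ∪ (Ω_j ∩ Zᶜ) for j = k, k − 1, …, h + 1, Ω″_j = Ω_j for j = h, h − 1, …, 1"* —
b02's display `OmegaPP Z″_j Ω_j Z` scale by scale. [cite: Balaban1989LargeFieldI, (1.12) p.179] -/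
def omegaPP (j : ℕ) : Set (Pt d) := if j ≤ h then Ω j else OmegaPP (Zpp L M k₀ R Ω E Z j) (Ω j) Z

variable {L M h k₀ R Ω E Z}

/-- `Ω″_j = Ω_j` for `j ≤ h`. [cite: Balaban1989LargeFieldI, (1.12) p.179] -/
theorem omegaPP_of_le {j : ℕ} (hj : j ≤ h) : omegaPP L M h k₀ R Ω E Z j = Ω j := by simp [omegaPP, hj]

/-- `Ω″_j = (Z″ᶜ_j ∩ Z) ∪ (Ω_j ∩ Zᶜ)` for `j > h`. [cite: Balaban1989LargeFieldI, (1.12) p.179] -/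
theorem omegaPP_of_lt {j : ℕ} (hj : h < j) :
    omegaPP L M h k₀ R Ω E Z j = OmegaPP (Zpp L M k₀ R Ω E Z j) (Ω j) Z := by
  have : ¬ j ≤ h := by omega
  simp [omegaPP, this]

/-- `Z″_j` in the middle regime `j ≤ k₀`. [cite: Balaban1989LargeFieldI, (1.11) p.179] -/
theorem zpp_of_le {j : ℕ} (hj : j ≤ k₀) : Zpp L M k₀ R Ω E Z j = farZ (side L M j * R j) 5 (Ω j) Z := by
  simp [Zpp, hj]

/-- `Z″_j` in the completion regime `j > k₀`. [cite: Balaban1989LargeFieldI, (1.10) p.179] -/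
theorem zpp_of_lt {j : ℕ} (hj : k₀ < j) : Zpp L M k₀ R Ω E Z j = (E j)ᶜ := by
  have : ¬ j ≤ k₀ := by omega
  simp [Zpp, this]

/-- Unfolding of `Ω″_j` in the middle regime `h < j ≤ k₀`: `Ω″_j = (Ω_j^{~5} ∩ Z) ∪ (Ω_j ∩ Zᶜ)`.
[cite: Balaban1989LargeFieldI, (1.12) p.179] -/
theorem mem_omegaPP_mid_iff {j : ℕ} (hj : h < j) (hjk : j ≤ k₀) (x : Pt d) :
    x ∈ omegaPP L M h k₀ R Ω E Z j ↔ (x ∈ enl (side L M j * R j) 5 (Ω j) ∧ x ∈ Z) ∨ (x ∈ Ω j ∧ x ∉ Z) := by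
  rw [omegaPP_of_lt hj, zpp_of_le hjk]
  simp only [OmegaPP, farZ, Set.mem_union, Set.mem_inter_iff, Set.mem_compl_iff]
  tauto

/-- Unfolding of `Ω″_j` in the completion regime `k₀ < j` (`h < k₀`): `Ω″_j = (E_j ∩ Z) ∪ (Ω_j ∩ Zᶜ)`.
[cite: Balaban1989LargeFieldI, (1.12) p.179] -/
theorem mem_omegaPP_high_iff (hhk : h < k₀) {j : ℕ} (hj : k₀ < j) (x : Pt d) :
    x ∈ omegaPP L M h k₀ R Ω E Z j ↔ (x ∈ E j ∧ x ∈ Z) ∨ (x ∈ Ω j ∧ x ∉ Z) := by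
  rw [omegaPP_of_lt (by omega), zpp_of_lt hj]
  simp only [OmegaPP, compl_compl, Set.mem_union, Set.mem_inter_iff, Set.mem_compl_iff]

end NewSequence

/-! ### The standing hypotheses of §§5–6 -/

section Main

variable {L M h k₀ k : ℕ} {R : ℕ → ℕ} {Ω E : ℕ → Set (Pt d)} {Z : Set (Pt d)}

/-- **The located geometric inputs of (1.12)** on the component class `Z` at step `k` (`h = k − N`, `k₀ = k − N₀`):
* `adm` — the old sequence `{Ω_j}_{j ≤ k}` is admissible ([III] (2.1)/(2.13); [IV] p. 179 presupposes it);
* `margin` — INSIDE `Z`, for the scales `h ≤ j ≤ k₀`, the domain `Ω_j` contains the eight-layer enlargement of `Ω_{j+1}` by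
  its `L^{−(k−j−1)}MR_{j+1}`-cubes: the plain one-step rule [III] (3.5) (`Ω_{j+1} ⊂ (Z′^{~8}_j)ᶜ`, `Z′_j ⊃ Λ_jᶜ ⊃ Ω_jᶜ`,
  pv02's `omega35_subset_compl_enl`), valid inside `Z` for the last `N` steps by p. 177 (ii) *"in the preceding N
  renormalization steps no new large field regions were created inside this component"*;
* `hN₀` — the defining equation of `N₀`, p. 179: *"L^{−N₀+1}MR_{k−N₀+1} = M"* (the `R`-cubes of scale `k₀+1` are the
  M-cubes of scale `k`);
* `classZ` — §3, for the `MR_k`-cubes and `Ω_k`;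
* `hhk : h < k₀` — *"We assume that N > N₀"*; `hk : k₀ + 2 ≤ k` — `N₀ ≥ 2` (the two members of (1.10) are distinct);
* `hR` — `R_j = Lʳ ≥ 1` ([III] (2.5)); `hL`, `hM`.
[cite: Balaban1989LargeFieldI, (1.10)–(1.12) p.179, p.177; Balaban1988Convergent, (2.13) p.256, (3.5) p.265] -/
structure Hypotheses (L M h k₀ k : ℕ) (R : ℕ → ℕ) (Ω : ℕ → Set (Pt d)) (Z : Set (Pt d)) : Prop where
  hL : 2 ≤ L
  hM : 1 ≤ M
  hR : ∀ j, 1 ≤ R j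
  hhk : h < k₀
  hk : k₀ + 2 ≤ k
  hN₀ : side L M (k₀ + 1) * R (k₀ + 1) = side L M k
  adm : Admissible L M k Ω
  margin : ∀ j, h ≤ j → j ≤ k₀ → Z ∩ enl (side L M (j + 1) * R (j + 1)) 8 (Ω (j + 1)) ⊆ Ω j
  classZ : ClassZ (side L M k * R k) Z (Ω k)

namespace Hypotheses

/-- `1 ≤ L`. [folklore] -/
private theorem hL1 (H : Hypotheses L M h k₀ k R Ω Z) : 1 ≤ L := le_trans (by norm_num) H.hL

/-- Nesting of the old sequence: `Ω_{j'} ⊆ Ω_j` for `j ≤ j' ≤ k`. [cite: Balaban1988Convergent, (2.1) p.254] -/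
theorem Ω_antitone (H : Hypotheses L M h k₀ k R Ω Z) {j j' : ℕ} (hjj' : j ≤ j') (hj' : j' ≤ k) : Ω j' ⊆ Ω j :=
  H.adm.antitone H.hL1 H.hM hjj' hj'

/-- `Z` is a union of `s_j`-cubes for every `j ≤ k` (it is one of `MR_k`-cubes). [cite: Balaban1989LargeFieldI, p.177] -/
theorem isUnionOfCubes_Z (H : Hypotheses L M h k₀ k R Ω Z) {j : ℕ} (hj : j ≤ k) : IsUnionOfCubes (side L M j) Z :=
  isUnionOfCubes_side_of_le hj H.classZ.cubes

/-- **Collar, outside**: a point outside `Z` within `s_{j+1} − 1` (`j < k`) of a point of `Z` lies in `Ω_k`, hence in every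
`Ω_j`. [cite: Balaban1989LargeFieldI, p.177] -/
theorem mem_Ω_of_near_Z (H : Hypotheses L M h k₀ k R Ω Z) {j : ℕ} (hj : j < k) {x y : Pt d} (hx : x ∈ Z) (hy : y ∉ Z)
    (hw : Within ((side L M (j + 1) : ℤ) - 1) x y) : y ∈ Ω j := by
  have hu : 0 < side L M k * R k := Nat.mul_pos (side_pos H.hL1 H.hM k) (H.hR k)
  have hle : side L M (j + 1) ≤ side L M k * R k := by
    calc side L M (j + 1) ≤ side L M k := by
          rw [side_eq_side_mul (show j + 1 ≤ k by omega)]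
          exact Nat.le_mul_of_pos_right _ (Nat.pow_pos (by have := H.hL1; omega))
      _ ≤ side L M k * R k := Nat.le_mul_of_pos_right _ (H.hR k)
  have hn : IdxNear (side L M k * R k) 1 y x := (idxNear_one_of_within hu hle hw).symm
  exact H.Ω_antitone (by omega) le_rfl (H.classZ.mem_of_adj hx hy hn)

/-- **The eight-layer margin at work**: for `h ≤ j ≤ k₀`, a point within `s_{j+1} − 1` of a point of `Z ∩ Ω_{j+1}^{~n}`,
`n ≤ 7` (the `L^{−(k−j−1)}MR_{j+1}`-cubes), lies in `Ω_j` — inside `Z` by `margin` (`n + 1 ≤ 8` layers), outside `Z` by the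
collar. [cite: Balaban1989LargeFieldI, (1.11) p.179; Balaban1988Convergent, (3.5) p.265] -/
theorem mem_Ω_of_near_enl (H : Hypotheses L M h k₀ k R Ω Z) {j n : ℕ} (hj : h ≤ j) (hjk : j ≤ k₀) (hn7 : n ≤ 7)
    {x y : Pt d} (hxZ : x ∈ Z) (hx : x ∈ enl (side L M (j + 1) * R (j + 1)) n (Ω (j + 1)))
    (hw : Within ((side L M (j + 1) : ℤ) - 1) x y) : y ∈ Ω j := by
  have hjk' : j < k := by have := H.hk; omega
  by_cases hyZ : y ∈ Z
  · have ht : 0 < side L M (j + 1) * R (j + 1) := Nat.mul_pos (side_pos H.hL1 H.hM (j + 1)) (H.hR (j + 1))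
    have h1 : IdxNear (side L M (j + 1) * R (j + 1)) 1 y x :=
      (idxNear_one_of_within ht (Nat.le_mul_of_pos_right _ (H.hR (j + 1))) hw).symm
    obtain ⟨z, hz, hxz⟩ := hx
    have h8 : y ∈ enl (side L M (j + 1) * R (j + 1)) 8 (Ω (j + 1)) :=
      ⟨z, hz, fun i => by have := (IdxNear.triangle h1 hxz) i; push_cast at this ⊢; omega⟩
    exact H.margin j hj hjk ⟨hyZ, h8⟩
  · exact H.mem_Ω_of_near_Z hjk' hxZ hyZ hw

variable (E)

/-- **`Ω_j ⊆ Ω″_j` for every `j ≤ k`** — the new domains ENLARGE the old ones (inside `Z`: `Ω_j ⊆ Ω_j^{~5}` resp.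
`Ω_j ⊆ Ω_{k₀+1} ⊆ Ω^{~5}_{k₀+1} ⊆ E_k ⊆ E_j`; outside `Z` nothing changes). [cite: Balaban1989LargeFieldI, (1.12) p.179] -/
theorem Ω_subset_omegaPP (H : Hypotheses L M h k₀ k R Ω Z) (hE : IsCompletion L M k₀ k (Ω (k₀ + 1)) Z E) {j : ℕ}
    (hjk : j ≤ k) : Ω j ⊆ omegaPP L M h k₀ R Ω E Z j := by
  intro y hy
  rcases Nat.lt_or_ge h j with hj | hj
  · rcases Nat.lt_or_ge k₀ j with hj' | hj'
    · rw [mem_omegaPP_high_iff H.hhk hj']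
      by_cases hyZ : y ∈ Z
      · refine Or.inl ⟨hE.enl_union_compl_subset H.hL1 H.hM (by omega) hjk (Or.inl ?_), hyZ⟩
        exact subset_enl _ 5 _ (H.Ω_antitone (by omega) hjk hy)
      · exact Or.inr ⟨hy, hyZ⟩
    · rw [mem_omegaPP_mid_iff hj hj']
      by_cases hyZ : y ∈ Z
      · exact Or.inl ⟨subset_enl _ 5 _ hy, hyZ⟩
      · exact Or.inr ⟨hy, hyZ⟩
  · rw [omegaPP_of_le hj]; exact hy

/-- RIDER: `Z″_j ⊆ Z` for `h < j ≤ k` (*"a new, much smaller large field region"*). [cite: Balaban1989LargeFieldI, (1.11) p.179] -/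
theorem zpp_subset_Z (H : Hypotheses L M h k₀ k R Ω Z) (hE : IsCompletion L M k₀ k (Ω (k₀ + 1)) Z E) {j : ℕ}
    (hjk : j ≤ k) : Zpp L M k₀ R Ω E Z j ⊆ Z := by
  rcases Nat.lt_or_ge k₀ j with hj' | hj'
  · rw [zpp_of_lt hj']
    intro x hx
    by_contra hxZ
    exact hx (hE.enl_union_compl_subset H.hL1 H.hM (by omega) hjk (Or.inr hxZ))
  · rw [zpp_of_le hj']; exact fun x hx => hx.2

/-- RIDER (r12's `B15DeterminingSets` hypothesis `Z″_j ∩ Ω_j = ∅`, `h < j ≤ k`, on this carrier): the new large-field regions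
avoid the old domains. [cite: Balaban1989LargeFieldI, (1.10)–(1.11) p.179] -/
theorem zpp_disjoint_Ω (H : Hypotheses L M h k₀ k R Ω Z) (hE : IsCompletion L M k₀ k (Ω (k₀ + 1)) Z E) {j : ℕ}
    (hjk : j ≤ k) : Disjoint (Zpp L M k₀ R Ω E Z j) (Ω j) := by
  rw [Set.disjoint_left]
  intro x hx hxΩ
  rcases Nat.lt_or_ge k₀ j with hj' | hj'
  · rw [zpp_of_lt hj'] at hx
    exact hx (hE.enl_union_compl_subset H.hL1 H.hM (by omega) hjk
      (Or.inl (subset_enl _ 5 _ (H.Ω_antitone (by omega) hjk hxΩ))))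
  · rw [zpp_of_le hj'] at hx
    exact hx.1 (subset_enl _ 5 _ hxΩ)

/-- RIDER (r12's Part G hypothesis "growth of `Z″_j` above `h`", on this carrier): `Z″_j ⊆ Z″_{j+1}` for `h < j < k` — in the
middle regime and across `k₀ → k₀ + 1` by the eight-layer margin, in the completion regime by its nesting.
[cite: Balaban1989LargeFieldI, (1.10)–(1.11) p.179] -/
theorem zpp_mono (H : Hypotheses L M h k₀ k R Ω Z) (hE : IsCompletion L M k₀ k (Ω (k₀ + 1)) Z E) {j : ℕ} (hj : h < j)
    (hjk : j < k) : Zpp L M k₀ R Ω E Z j ⊆ Zpp L M k₀ R Ω E Z (j + 1) := by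
  intro x hx
  rcases Nat.lt_or_ge k₀ j with hj' | hj'
  · rw [zpp_of_lt hj'] at hx
    rw [zpp_of_lt (by omega)]
    exact fun h' => hx (hE.subset_succ H.hL1 H.hM (by omega) hjk h')
  · rw [zpp_of_le hj'] at hx
    obtain ⟨hx5, hxZ⟩ := hx
    have hst : 0 < side L M (j + 1) := side_pos H.hL1 H.hM (j + 1)
    rcases Nat.lt_or_ge j k₀ with hj'' | hj''
    · rw [zpp_of_le (by omega)]
      refine ⟨fun hx5' => hx5 (subset_enl _ 5 _ ?_), hxZ⟩
      exact H.mem_Ω_of_near_enl (by omega) hj' (by norm_num) hxZ hx5' (Within.refl (by omega) x)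
    · have hjk₀ : j = k₀ := le_antisymm hj' hj''
      subst hjk₀
      rw [zpp_of_lt (Nat.lt_succ_self j), hE.bot, compl_compl]
      refine ⟨fun hx7 => hx5 (subset_enl _ 5 _ ?_), hxZ⟩
      rw [← H.hN₀] at hx7
      exact H.mem_Ω_of_near_enl (by omega) le_rfl (by norm_num) hxZ hx7 (Within.refl (by omega) x)

/-- RIDER (r12's Part G hypothesis `Z ∖ Z″_{h+1} ⊆ Ω_h`, on this carrier): the part of `Z` not in the first new large-field
region lies in `Ω_h` (`Z ∩ Ω^{~5}_{h+1} ⊆ Ω_h` by the margin). [cite: Balaban1989LargeFieldI, (1.11) p.179] -/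
theorem Z_diff_zpp_subset (H : Hypotheses L M h k₀ k R Ω Z) : Z \ Zpp L M k₀ R Ω E Z (h + 1) ⊆ Ω h := by
  intro x hx
  have hh : h + 1 ≤ k₀ := H.hhk
  rw [zpp_of_le hh] at hx
  obtain ⟨hxZ, hx'⟩ := hx
  have hx5 : x ∈ enl (side L M (h + 1) * R (h + 1)) 5 (Ω (h + 1)) := by
    by_contra hc; exact hx' ⟨hc, hxZ⟩
  exact H.mem_Ω_of_near_enl le_rfl (by omega) (by norm_num) hxZ hx5
    (Within.refl (by have := side_pos H.hL1 H.hM (h + 1); omega) x)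

/-! ## §6. (1.12): «The sequence {Ω″_j} is an admissible sequence» -/

/-- **Cube unions**: every `Ω″_j`, `j ≤ k`, is a union of `s_j`-cubes (M-cubes of the scale `j`): `Ω_j^{~5}` is a union of
`s_jR_j`-cubes, `E_j` of `s_j`-cubes, `Ω_j` of `s_j`-cubes, `Z` of `s_kR_k`-cubes — and the partitions are compatible.
[cite: Balaban1989LargeFieldI, (1.12) p.179] -/
theorem isUnionOfCubes_omegaPP (H : Hypotheses L M h k₀ k R Ω Z) (hE : IsCompletion L M k₀ k (Ω (k₀ + 1)) Z E) {j : ℕ}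
    (hjk : j ≤ k) : IsUnionOfCubes (side L M j) (omegaPP L M h k₀ R Ω E Z j) := by
  have hZj := H.isUnionOfCubes_Z hjk
  have hΩj := H.adm.cubes j hjk
  rcases Nat.lt_or_ge h j with hj | hj
  · rw [omegaPP_of_lt hj]
    have key : IsUnionOfCubes (side L M j) ((Zpp L M k₀ R Ω E Z j)ᶜ ∩ Z) := by
      rcases Nat.lt_or_ge k₀ j with hj' | hj'
      · rw [zpp_of_lt hj', compl_compl]
        exact isUnionOfCubes_inter (hE.cubes j (by omega) hjk) hZj
      · rw [zpp_of_le hj']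
        have e : (farZ (side L M j * R j) 5 (Ω j) Z)ᶜ ∩ Z = enl (side L M j * R j) 5 (Ω j) ∩ Z := by
          ext x; simp only [farZ, Set.mem_inter_iff, Set.mem_compl_iff]; tauto
        rw [e]
        exact isUnionOfCubes_inter (isUnionOfCubes_of_mul (isUnionOfCubes_enl _ 5 _)) hZj
    exact isUnionOfCubes_union key (isUnionOfCubes_inter hΩj hZj.compl)
  · rw [omegaPP_of_le hj]; exact hΩj

/-- **One-layer separation**: for `j < k`, every point within sup-distance `< s_{j+1}` of `Ω″_{j+1}` lies in `Ω″_j` — by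
cases: below `h` the old admissibility; at and above `h` inside `Z` the eight-layer margin (middle regime, and the passage
`k₀ + 1 → k₀` through `hN₀`) resp. the completion's own separation; across `∂Z` the collar lemma; outside `Z` the old
admissibility and `Ω_j ⊆ Ω″_j`. [cite: Balaban1989LargeFieldI, (1.12) p.179] -/
theorem sep_omegaPP (H : Hypotheses L M h k₀ k R Ω Z) (hE : IsCompletion L M k₀ k (Ω (k₀ + 1)) Z E) {j : ℕ} (hjk : j < k)
    {x y : Pt d} (hx : x ∈ omegaPP L M h k₀ R Ω E Z (j + 1)) (hw : Within ((side L M (j + 1) : ℤ) - 1) x y) :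
    y ∈ omegaPP L M h k₀ R Ω E Z j := by
  have hΩΩ : Ω j ⊆ omegaPP L M h k₀ R Ω E Z j := H.Ω_subset_omegaPP E hE (by omega)
  rcases Nat.lt_or_ge h (j + 1) with hj1 | hj1
  · -- `j + 1 > h`
    rcases Nat.lt_or_ge k₀ (j + 1) with hj2 | hj2
    · -- `j + 1 > k₀`: completion regime for `Ω″_{j+1}`
      rw [mem_omegaPP_high_iff H.hhk hj2] at hx
      rcases hx with ⟨hxE, hxZ⟩ | ⟨hxΩ, hxZ⟩
      · rcases Nat.lt_or_ge k₀ j with hj3 | hj3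
        · -- `j > k₀` too: the completion's separation
          have hyE : y ∈ E j := hE.sep j (by omega) hjk x hxE y hw
          by_cases hyZ : y ∈ Z
          · rw [mem_omegaPP_high_iff H.hhk hj3]; exact Or.inl ⟨hyE, hyZ⟩
          · exact hΩΩ (H.mem_Ω_of_near_Z hjk hxZ hyZ hw)
        · -- `j = k₀`: `E_{k₀+1} = Ω^{~7}_{k₀+1} ∪ Zᶜ`, margin through `hN₀`
          have hjk₀ : j = k₀ := by omega
          subst hjk₀
          rw [hE.bot] at hxE
          have hx7 : x ∈ enl (side L M (j + 1) * R (j + 1)) 7 (Ω (j + 1)) := by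
            rw [H.hN₀]
            by_contra hc; exact hxE ⟨hc, hxZ⟩
          exact hΩΩ (H.mem_Ω_of_near_enl (le_of_lt H.hhk) le_rfl le_rfl hxZ hx7 hw)
      · exact hΩΩ (H.adm.sep j hjk x hxΩ y hw)
    · -- `h < j + 1 ≤ k₀`: middle regime for `Ω″_{j+1}`
      rw [mem_omegaPP_mid_iff hj1 hj2] at hx
      rcases hx with ⟨hx5, hxZ⟩ | ⟨hxΩ, hxZ⟩
      · exact hΩΩ (H.mem_Ω_of_near_enl (by omega) (by omega) (by norm_num) hxZ hx5 hw)
      · exact hΩΩ (H.adm.sep j hjk x hxΩ y hw)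
  · -- `j + 1 ≤ h`: the old sequence
    rw [omegaPP_of_le hj1] at hx
    rw [omegaPP_of_le (by omega)]
    exact H.adm.sep j hjk x hx y hw

/-- **[IV] (1.12), p. 179: «The sequence {Ω″_j} is an admissible sequence»** — for every completion of (1.10) with the printed
properties, under the located hypotheses `Hypotheses`; admissibility in the [III] (2.13) sense of r11 (`Admissible`).
[cite: Balaban1989LargeFieldI, (1.12) p.179; Balaban1988Convergent, (2.13) p.256] -/
theorem admissible_omegaPP (H : Hypotheses L M h k₀ k R Ω Z) (hE : IsCompletion L M k₀ k (Ω (k₀ + 1)) Z E) :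
    Admissible L M k (omegaPP L M h k₀ R Ω E Z) :=
  ⟨fun _ hjk => H.isUnionOfCubes_omegaPP E hE hjk, fun _ hjk _ hx _ hw => H.sep_omegaPP E hE hjk hx hw⟩

/-- **(1.10) + (1.12) together, no completion assumed**: with the CONSTRUCTED completion of §4 the sequence `{Ω″_j}_{j ≤ k}` is
admissible. [cite: Balaban1989LargeFieldI, (1.10)–(1.12) p.179] -/
theorem admissible_omegaPP_completion (H : Hypotheses L M h k₀ k R Ω Z) :
    Admissible L M k (omegaPP L M h k₀ R Ω (completion L M k₀ k (Ω (k₀ + 1)) Z) Z) :=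
  H.admissible_omegaPP _ (isCompletion_completion H.hL H.hM H.hk (H.hR k) H.classZ
    (H.Ω_antitone (by have := H.hk; omega) le_rfl))

/-- Hence the new sequence is nested, `Ω″_{j'} ⊆ Ω″_j` for `j ≤ j' ≤ k` (r12's `omegaPP_antitone`, here a COROLLARY of
admissibility). [cite: Balaban1989LargeFieldI, (1.12) p.179] -/
theorem omegaPP_antitone (H : Hypotheses L M h k₀ k R Ω Z) (hE : IsCompletion L M k₀ k (Ω (k₀ + 1)) Z E) {j j' : ℕ}
    (hjj' : j ≤ j') (hj' : j' ≤ k) : omegaPP L M h k₀ R Ω E Z j' ⊆ omegaPP L M h k₀ R Ω E Z j :=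
  (H.admissible_omegaPP E hE).antitone H.hL1 H.hM hjj' hj'

/-- Hence r11's maximality applies to THE sequence of (1.12): `Ω″_j ⊆ maxDom L M Ω″₀ j`, `j ≤ k`.
[cite: Balaban1989LargeFieldI, (1.12) p.179; Balaban1988Convergent, (2.13) p.256] -/
theorem omegaPP_subset_maxDom (H : Hypotheses L M h k₀ k R Ω Z) (hE : IsCompletion L M k₀ k (Ω (k₀ + 1)) Z E) {j : ℕ}
    (hjk : j ≤ k) : omegaPP L M h k₀ R Ω E Z j ⊆ maxDom L M (omegaPP L M h k₀ R Ω E Z 0) j :=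
  (H.admissible_omegaPP E hE).subset_maxDom hjk

/-- **Hence the (1.47) input holds for THE sequence of (1.12)** (*"Thus, by the definition of the domains Z″_i, we obtain
… (1.47)"*, p. 186): on the bond-cube graph of the new large-field regions `(Ω″_n)ᶜ`, every admissible contour from a
scale-`≤ i` bond cube to one meeting `Ω″_{j+1}` has length `≥ (M/M₁)(j − i)` — `B15Ineq147Admissible` BY NAME, its last
hypothesis (admissibility) now DISCHARGED for the actual (1.12) sequence. [cite: Balaban1989LargeFieldI, (1.47) p.186, (1.12) p.179] -/
theorem ineq147_walk_omegaPP (H : Hypotheses L M h k₀ k R Ω Z) (hE : IsCompletion L M k₀ k (Ω (k₀ + 1)) Z E)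
    {M₁ : ℕ} (hM₁ : 0 < M₁) (hdvd : M₁ ∣ M) {i j : ℕ} (hj : j < k)
    {s t : CubeSite M₁ L (fun n => (Admissible.extend k (omegaPP L M h k₀ R Ω E Z) n)ᶜ)}
    (p : (bondC M₁ L (fun n => (Admissible.extend k (omegaPP L M h k₀ R Ω E Z) n)ᶜ)).Walk s t) (hs : zoneC s ≤ i)
    (ht : ∃ x ∈ cube M₁ L t.1.1 t.1.2, x ∈ omegaPP L M h k₀ R Ω E Z (j + 1)) {δ : ℝ} (hδ : 0 ≤ δ) :
    B15.PrelimIntegrations.Ineq147 δ (p.length : ℝ) M M₁ ((j - i : ℕ) : ℝ) :=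
  (H.admissible_omegaPP E hE).ineq147_walk hM₁ hdvd (by have := H.hM; omega) H.hL hj p hs ht hδ

end Hypotheses

end Main

/-! ## §7. A `d = 1` instance: the hypotheses are jointly satisfiable with `Z ≠ ∅` -/

section Instance

/-- A point of `ℤ¹`. [folklore] -/
private def pt1 (a : ℤ) : Pt 1 := fun _ => a

/-- The old domains of the instance (`L = 2`, `M = 1`, `h = 0`, `k₀ = 1`, `k = 3`): `Ω₀ = Ω₁ = ℤ`,
`Ω₂ = {x < 8} ∪ {x ≥ 792}`, `Ω₃ = {x < 0} ∪ {x ≥ 800}` (and `Ω_j = Ω₃` above). [folklore] -/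
private def Ωinst (j : ℕ) : Set (Pt 1) :=
  if j ≤ 1 then Set.univ else if j = 2 then {x | x 0 < 8 ∨ 792 ≤ x 0} else {x | x 0 < 0 ∨ 800 ≤ x 0}

/-- The component `Z = [0, 800)` = `Ω₃ᶜ` of the instance. [folklore] -/
private def Zinst : Set (Pt 1) := {x | 0 ≤ x 0 ∧ x 0 < 800}

/-- `R₂ = 2` (so that `L²MR₂ = L³M`), all other `R_j = 1`. [folklore] -/
private def Rinst (j : ℕ) : ℕ := if j = 2 then 2 else 1

/-- In `ℤ¹` the cube index is the floor quotient of the only coordinate. [folklore] -/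
private theorem cubeIdx_eq_iff (s : ℕ) (x y : Pt 1) : cubeIdx s x = cubeIdx s y ↔ x 0 / (s : ℤ) = y 0 / (s : ℤ) := by
  constructor
  · intro h; exact congrFun h 0
  · intro h; funext i; fin_cases i; exact h

/-- **Non-vacuity instance** of the located hypotheses of (1.10)–(1.12): `Hypotheses` holds for the `d = 1` data above, whose
`Z` is non-empty (so §4/§6 are not vacuous). [cite: Balaban1989LargeFieldI, (1.10)–(1.12) p.179] -/
theorem hypotheses_instance : Hypotheses 2 1 0 1 3 Rinst Ωinst Zinst ∧ Zinst.Nonempty := by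
  refine ⟨⟨le_rfl, le_rfl, fun j => by unfold Rinst; split_ifs <;> omega, by norm_num, by norm_num,
    by simp [side, Rinst], ⟨?_, ?_⟩, ?_, ⟨?_, ?_⟩⟩, ⟨pt1 0, by simp [Zinst, pt1]⟩⟩
  · -- cubes of `Ω_j`
    intro j hj x y hxy
    rw [cubeIdx_eq_iff] at hxy
    unfold Ωinst
    interval_cases j <;> simp [side] at hxy ⊢ <;> omega
  · -- separation of `Ω_j`
    intro j hj x hx y hy
    have hy0 := abs_le.mp (hy 0)
    unfold Ωinst at hx ⊢
    interval_cases j <;> simp [side] at hx hy0 ⊢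
    omega
  · -- margin: `Ω₀ = Ω₁ = ℤ`
    intro j hj hj1 x _
    unfold Ωinst
    interval_cases j <;> simp
  · -- `Z` is a union of `8`-cubes
    intro x y hxy
    rw [cubeIdx_eq_iff] at hxy
    simp only [side, Rinst] at hxy
    norm_num at hxy
    simp only [Zinst, Set.mem_setOf_eq]
    omega
  · -- closedness: `Ω₃ᶜ = Z`
    intro x y _ hx _
    simp only [Ωinst, Zinst, Set.mem_setOf_eq] at hx ⊢
    norm_num at hx
    omega

end Instance

/-! ## §8 (v1.1). [B6] Lemma 2.1 (2.60)–(2.63) with the d-only c₁″ for the lattice-contour geometry of THE (1.12) sequence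

`B15LatticeCubeContours.lemma21_full_latGeo_admissible` (p29 g12) proved [Balaban1984PropagatorsII] Lemma 2.1 in the corrected
form (`Ineq260`, `Ineq261With/262With/263With c1TwoScale`) for the lattice-contour geometry `latGeo` of EVERY [III]
(2.13)-admissible sequence of nested-cube domains of `ℤᵈ` whose finest member is everything and which is exhausted after
finitely many scales.  By §6 the sequence `{Ω″_j}_{j ≤ k}` of (1.12) (extended by `∅` above `k`) is such a sequence as soon
as `Ω₀ = T_η` ([III] (2.2): `Γ₀ = Ω₁ᶜ`, the finest scale carries everything outside `Ω₁`) — so the row sums (2.61) that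
[IV] (1.47)/(1.48) use on the new domains hold for THE domains of the 𝐑-operation, BY NAME. -/

section Lemma21

namespace Admissible

variable {L M k : ℕ} {D : ℕ → Set (Pt d)}

/-- The extension has unions of cubes at every scale (scale `0` included). [cite: Balaban1988Convergent, (2.13) p.256] -/
theorem extend_cubes_all (hA : Admissible L M k D) : ∀ n, IsUnionOfCubes (side L M n) (extend k D n) := by
  intro n
  cases n with
  | zero => rw [extend_of_le (Nat.zero_le k)]; exact hA.cubes 0 (Nat.zero_le k)
  | succ n => exact hA.extend_cubes n

/-- The extension is exhausted above `k` (every point leaves the sequence). [folklore] -/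
private theorem extend_exhaust (k : ℕ) (D : ℕ → Set (Pt d)) : ∀ x : Pt d, ∃ n, x ∉ extend k D n :=
  fun x => ⟨k + 1, by rw [extend_of_lt (Nat.lt_succ_self k)]; exact fun h => h⟩

/-- **[B6] Lemma 2.1 with c₁″ for every admissible sequence up to `k` with `D₀ = T_η`** — p29 g12's
`lemma21_full_latGeo_admissible` BY NAME on the extension: all four displays (2.60)–(2.63) in the corrected form, for the
lattice-contour geometry on any finite set of bond cubes of the layers `(D_n)ᶜ`, `0 < α < 1`, (2.59).
[cite: Balaban1984PropagatorsII, Lemma 2.1 (2.60)–(2.63) p.234; Balaban1988Convergent, (2.13) p.256] -/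
theorem lemma21_full_latGeo [NeZero d] (hA : Admissible L M k D) (h0 : D 0 = Set.univ) {M₁ : ℕ} (hM₁ : 0 < M₁)
    (hM : 1 ≤ M) (hdvd : M₁ ∣ M) (hL : 2 ≤ L) (F : Finset (CubeSite M₁ L (fun n => (extend k D n)ᶜ))) (kk : ℕ)
    (η R Mr : ℝ) (hRM : R * Mr ≤ ((M / M₁ : ℕ) : ℝ)) (hN : 2 ≤ M / M₁) {δ₀ : ℝ} (hδ : 0 < δ₀) :
    ∀ α : ℝ, 0 < α → α < 1 → B6.Cond259 d δ₀ α R Mr →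
      B6RandomWalk.Ineq260 (B15LatticeCubeContours.latGeo M₁ L (fun n => (extend k D n)ᶜ) F kk η R Mr) δ₀ α ∧
        B6Lemma21Repaired.Ineq261With (B6Lemma21TwoScale.c1TwoScale d δ₀ α)
          (B15LatticeCubeContours.latGeo M₁ L (fun n => (extend k D n)ᶜ) F kk η R Mr) δ₀ α ∧
        B6Lemma21Repaired.Ineq262With (B6Lemma21TwoScale.c1TwoScale d δ₀ α)
          (B15LatticeCubeContours.latGeo M₁ L (fun n => (extend k D n)ᶜ) F kk η R Mr) δ₀ α ∧
        B6Lemma21Repaired.Ineq263With (B6Lemma21TwoScale.c1TwoScale d δ₀ α)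
          (B15LatticeCubeContours.latGeo M₁ L (fun n => (extend k D n)ᶜ) F kk η R Mr) δ₀ α :=
  B15LatticeCubeContours.lemma21_full_latGeo_admissible hA.extend_sep hA.extend_cubes_all
    (by rw [extend_of_le (Nat.zero_le k)]; exact h0) (extend_exhaust k D) hM₁ hM hdvd hL F kk η R Mr hRM hN hδ

end Admissible

namespace Hypotheses

variable {L M h k₀ k : ℕ} {R : ℕ → ℕ} {Ω E : ℕ → Set (Pt d)} {Z : Set (Pt d)}

/-- With `Ω₀ = T_η` the finest new domain is everything too: `Ω″₀ = Ω₀ = T_η`. [cite: Balaban1989LargeFieldI, (1.12) p.179] -/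
theorem omegaPP_zero (hΩ0 : Ω 0 = Set.univ) : omegaPP L M h k₀ R Ω E Z 0 = Set.univ := by
  rw [omegaPP_of_le (Nat.zero_le h), hΩ0]

variable (E)

/-- **[B6] Lemma 2.1 (2.60)–(2.63) with c₁″ FOR THE (1.12) SEQUENCE `{Ω″_j}`** of the 𝐑-operation (any completion of
(1.10) with the printed properties; `Ω₀ = T_η`): the corrected Lemma 2.1 of p29 g12 holds for the lattice-contour geometry on
any finite set of bond cubes (side `M₁Lⁿ`, `M₁ ∣ M`, `2 ≤ M/M₁`, `Rr·M_r ≤ M/M₁`) of the new large-field layers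
`(Ω″_n)ᶜ` — the (2.61)-type row sums [IV] (1.47)/(1.48) invoke *"by the definition of the domains Z″_i"*, now for THE
domains. [cite: Balaban1989LargeFieldI, (1.12) p.179, (1.47) p.186; Balaban1984PropagatorsII, Lemma 2.1 p.234] -/
theorem lemma21_full_latGeo_omegaPP [NeZero d] (H : Hypotheses L M h k₀ k R Ω Z)
    (hE : IsCompletion L M k₀ k (Ω (k₀ + 1)) Z E) (hΩ0 : Ω 0 = Set.univ) {M₁ : ℕ} (hM₁ : 0 < M₁) (hdvd : M₁ ∣ M)
    (F : Finset (CubeSite M₁ L (fun n => (Admissible.extend k (omegaPP L M h k₀ R Ω E Z) n)ᶜ))) (kk : ℕ)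
    (η Rr Mr : ℝ) (hRM : Rr * Mr ≤ ((M / M₁ : ℕ) : ℝ)) (hN : 2 ≤ M / M₁) {δ₀ : ℝ} (hδ : 0 < δ₀) :
    ∀ α : ℝ, 0 < α → α < 1 → B6.Cond259 d δ₀ α Rr Mr →
      B6RandomWalk.Ineq260
          (B15LatticeCubeContours.latGeo M₁ L (fun n => (Admissible.extend k (omegaPP L M h k₀ R Ω E Z) n)ᶜ)
            F kk η Rr Mr) δ₀ α ∧
        B6Lemma21Repaired.Ineq261With (B6Lemma21TwoScale.c1TwoScale d δ₀ α)
          (B15LatticeCubeContours.latGeo M₁ L (fun n => (Admissible.extend k (omegaPP L M h k₀ R Ω E Z) n)ᶜ)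
            F kk η Rr Mr) δ₀ α ∧
        B6Lemma21Repaired.Ineq262With (B6Lemma21TwoScale.c1TwoScale d δ₀ α)
          (B15LatticeCubeContours.latGeo M₁ L (fun n => (Admissible.extend k (omegaPP L M h k₀ R Ω E Z) n)ᶜ)
            F kk η Rr Mr) δ₀ α ∧
        B6Lemma21Repaired.Ineq263With (B6Lemma21TwoScale.c1TwoScale d δ₀ α)
          (B15LatticeCubeContours.latGeo M₁ L (fun n => (Admissible.extend k (omegaPP L M h k₀ R Ω E Z) n)ᶜ)
            F kk η Rr Mr) δ₀ α :=
  (H.admissible_omegaPP E hE).lemma21_full_latGeo (omegaPP_zero hΩ0) hM₁ H.hM hdvd H.hL F kk η Rr Mr hRM hN hδ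

end Hypotheses

end Lemma21

/-! ## §9 (v1.2). The same ON THE TORUS `T = ℤᵈ/(P₁ℤ × ⋯ × P_dℤ)`: the (1.10)–(1.12) construction commutes with the deck
translations, so for periodic data THE (1.12) sequence is a periodic [III] (2.13)-admissible sequence with finitely many
scales and p29 g12/g13's torus Lemma 2.1 (`B15LatticeCubeTorus.lemma21_full_torGeo_admissible`, print's distance (2.46) read
literally on `T_η`) applies to it BY NAME

Print's `Ω_j`, `Z` are subsets of the torus `T_η`; on the cover `ℤᵈ` they are sets invariant under `x ↦ x + P·v`, `v ∈ ℤᵈ`,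
with every cube side in use dividing the periods (`LᵏM ∣ P_μ`, `LʲMR_j ∣ P_μ`).  §9.1: cube indices, `X ↦ X~ⁿ` (`enl`), `farZ`,
`OmegaPP`, `widen`, `completion`, `Zpp`, `omegaPP` all commute with the deck translations (finite set algebra).  §9.2: hence
the periodicity datum `IsPeriodic` of p29 g12 for `{(Ω″_j)ᶜ}` (via g13's `isPeriodic_of_admissible`) and [B6] Lemma 2.1
(2.60)–(2.63) with `c₁″` for the TORUS-contour geometry `torGeo` of THE (1.12) domains; §9.3: for arbitrary (non-periodic)
cover data the same for the INTERSECTED domains `interD` of g13 (`lemma21_full_torGeo_interD` BY NAME). -/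

section Torus

open B15LatticeCubeTorus B15LatticeCubeTorusNestedBoxes

/-! ### §9.1 The construction commutes with the deck translations `x ↦ x + P·v` -/

section Deck

variable {P : Fin d → ℕ}

/-- `P·(−v) = −P·v`. [folklore] -/
private theorem pmul_neg' (P : Fin d → ℕ) (v : Pt d) : pmul P (-v) = -pmul P v := by
  ext μ; simp [pmul]

/-- One-sided invariance under all deck translations is two-sided. [folklore] -/
private theorem deck_iff_of_imp {X : Set (Pt d)} (h : ∀ x v, x ∈ X → x + pmul P v ∈ X) (x v : Pt d) :
    x + pmul P v ∈ X ↔ x ∈ X := by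
  refine ⟨fun hx => ?_, h x v⟩
  have := h _ (-v) hx
  rwa [pmul_neg', add_neg_cancel_right] at this

/-- Cube indices shift by `(P_μ/s)·v_μ` under `x ↦ x + P·v` when `s ∣ P_μ`. [folklore] -/
private theorem cubeIdx_add_pmul {s : ℕ} (hs : 0 < s) (hdvd : ∀ μ, s ∣ P μ) (x v : Pt d) (i : Fin d) :
    cubeIdx s (x + pmul P v) i = cubeIdx s x i + ((P i / s : ℕ) : ℤ) * v i := by
  have hs' : (s : ℤ) ≠ 0 := by exact_mod_cast hs.ne'
  have hP : (P i : ℤ) = ((P i / s : ℕ) : ℤ) * (s : ℤ) := by exact_mod_cast (Nat.div_mul_cancel (hdvd i)).symm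
  simp only [cubeIdx, Pi.add_apply, pmul]
  rw [hP, show x i + ((P i / s : ℕ) : ℤ) * (s : ℤ) * v i = x i + ((P i / s : ℕ) : ℤ) * v i * (s : ℤ) by ring,
    Int.add_mul_ediv_right _ _ hs']

/-- `IdxNear` is invariant under simultaneous deck translation. [folklore] -/
private theorem idxNear_add_pmul {s n : ℕ} (hs : 0 < s) (hdvd : ∀ μ, s ∣ P μ) (x y v : Pt d) :
    IdxNear s n (x + pmul P v) (y + pmul P v) ↔ IdxNear s n x y := by
  simp only [IdxNear, cubeIdx_add_pmul hs hdvd, add_sub_add_right_eq_sub]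

/-- `X ↦ X~ⁿ` commutes with the deck translations. [folklore] -/
private theorem deck_enl {s n : ℕ} (hs : 0 < s) (hdvd : ∀ μ, s ∣ P μ) {X : Set (Pt d)}
    (hX : ∀ x v, x + pmul P v ∈ X ↔ x ∈ X) (x v : Pt d) : x + pmul P v ∈ enl s n X ↔ x ∈ enl s n X := by
  refine deck_iff_of_imp (fun x v hx => ?_) x v
  obtain ⟨y, hy, hn⟩ := hx
  exact ⟨y + pmul P v, (hX y v).2 hy, (idxNear_add_pmul hs hdvd x y v).2 hn⟩

/-- Complements of invariant sets are invariant. [folklore] -/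
private theorem deck_compl {X : Set (Pt d)} (hX : ∀ x v, x + pmul P v ∈ X ↔ x ∈ X) (x v : Pt d) :
    x + pmul P v ∈ Xᶜ ↔ x ∈ Xᶜ := by
  simp only [Set.mem_compl_iff, hX]

/-- Intersections of invariant sets are invariant. [folklore] -/
private theorem deck_inter {X Y : Set (Pt d)} (hX : ∀ x v, x + pmul P v ∈ X ↔ x ∈ X)
    (hY : ∀ x v, x + pmul P v ∈ Y ↔ x ∈ Y) (x v : Pt d) : x + pmul P v ∈ X ∩ Y ↔ x ∈ X ∩ Y := by
  simp only [Set.mem_inter_iff, hX, hY]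

/-- Unions of invariant sets are invariant. [folklore] -/
private theorem deck_union {X Y : Set (Pt d)} (hX : ∀ x v, x + pmul P v ∈ X ↔ x ∈ X)
    (hY : ∀ x v, x + pmul P v ∈ Y ↔ x ∈ Y) (x v : Pt d) : x + pmul P v ∈ X ∪ Y ↔ x ∈ X ∪ Y := by
  simp only [Set.mem_union, hX, hY]

/-- `farZ` ((1.10)/(1.11): `(Ω^{~n})ᶜ ∩ Z`) commutes with the deck translations. [folklore] -/
private theorem deck_farZ {s n : ℕ} (hs : 0 < s) (hdvd : ∀ μ, s ∣ P μ) {Ω Z : Set (Pt d)}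
    (hΩ : ∀ x v, x + pmul P v ∈ Ω ↔ x ∈ Ω) (hZ : ∀ x v, x + pmul P v ∈ Z ↔ x ∈ Z) (x v : Pt d) :
    x + pmul P v ∈ farZ s n Ω Z ↔ x ∈ farZ s n Ω Z := by
  unfold farZ
  exact deck_inter (deck_compl (deck_enl hs hdvd hΩ)) hZ x v

/-- The (1.12) display `OmegaPP` commutes with the deck translations. [folklore] -/
private theorem deck_OmegaPP {Zpp' Ω' Z : Set (Pt d)} (hZpp : ∀ x v, x + pmul P v ∈ Zpp' ↔ x ∈ Zpp')
    (hΩ : ∀ x v, x + pmul P v ∈ Ω' ↔ x ∈ Ω') (hZ : ∀ x v, x + pmul P v ∈ Z ↔ x ∈ Z) (x v : Pt d) :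
    x + pmul P v ∈ OmegaPP Zpp' Ω' Z ↔ x ∈ OmegaPP Zpp' Ω' Z := by
  unfold OmegaPP
  exact deck_union (deck_inter (deck_compl hZpp) hZ) (deck_inter hΩ (deck_compl hZ)) x v

/-- Lower scales divide higher ones: `LʲM ∣ LᵏM` for `j ≤ k`. [folklore] -/
private theorem side_dvd_side {L M j k : ℕ} (hjk : j ≤ k) : side L M j ∣ side L M k :=
  Dvd.intro _ (side_eq_side_mul hjk).symm

variable {L M h k₀ k : ℕ} {R : ℕ → ℕ}

/-- `widen` commutes with the deck translations (`LᵏM ∣ P_μ`). [folklore] -/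
private theorem deck_widen (hL : 1 ≤ L) (hM : 1 ≤ M) (hdvd : ∀ μ, side L M k ∣ P μ) {X : Set (Pt d)}
    (hX : ∀ x v, x + pmul P v ∈ X ↔ x ∈ X) :
    ∀ m (x v : Pt d), x + pmul P v ∈ widen L M k X m ↔ x ∈ widen L M k X m
  | 0, x, v => hX x v
  | m + 1, x, v =>
    deck_enl (side_pos hL hM (k - m)) (fun μ => (side_dvd_side (Nat.sub_le k m)).trans (hdvd μ))
      (deck_widen hL hM hdvd hX m) x v

/-- The §4 completion commutes with the deck translations (`LᵏM ∣ P_μ`). [folklore] -/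
private theorem deck_completion (hL : 1 ≤ L) (hM : 1 ≤ M) (hdvd : ∀ μ, side L M k ∣ P μ) {Ω Z : Set (Pt d)}
    (hΩ : ∀ x v, x + pmul P v ∈ Ω ↔ x ∈ Ω) (hZ : ∀ x v, x + pmul P v ∈ Z ↔ x ∈ Z) (j : ℕ) (x v : Pt d) :
    x + pmul P v ∈ completion L M k₀ k Ω Z j ↔ x ∈ completion L M k₀ k Ω Z j := by
  unfold completion Zk Zk0
  split_ifs
  · exact deck_compl (deck_farZ (side_pos hL hM k) hdvd hΩ hZ) x v
  · exact deck_widen hL hM hdvd (deck_compl (deck_farZ (side_pos hL hM k) hdvd hΩ hZ)) (k - j) x v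

/-- (1.11) `Zpp` commutes with the deck translations (`LʲMR_j ∣ P_μ` for `j ≤ k₀`; `E_j` invariant above). [folklore] -/
private theorem deck_Zpp (hL : 1 ≤ L) (hM : 1 ≤ M) (hR : ∀ j, 1 ≤ R j) (hdj : ∀ j, j ≤ k₀ → ∀ μ, side L M j * R j ∣ P μ)
    {Ω E : ℕ → Set (Pt d)} {Z : Set (Pt d)} (hΩ : ∀ j x v, x + pmul P v ∈ Ω j ↔ x ∈ Ω j)
    (hE : ∀ j, k₀ < j → ∀ x v, x + pmul P v ∈ E j ↔ x ∈ E j) (hZ : ∀ x v, x + pmul P v ∈ Z ↔ x ∈ Z) (j : ℕ)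
    (x v : Pt d) : x + pmul P v ∈ Zpp L M k₀ R Ω E Z j ↔ x ∈ Zpp L M k₀ R Ω E Z j := by
  unfold Zpp
  split_ifs with hj
  · exact deck_farZ (Nat.mul_pos (side_pos hL hM j) (hR j)) (hdj j hj) (hΩ j) hZ x v
  · exact deck_compl (hE j (Nat.lt_of_not_le hj)) x v

/-- (1.12) `omegaPP` commutes with the deck translations. [folklore] -/
private theorem deck_omegaPP (hL : 1 ≤ L) (hM : 1 ≤ M) (hR : ∀ j, 1 ≤ R j)
    (hdj : ∀ j, j ≤ k₀ → ∀ μ, side L M j * R j ∣ P μ) {Ω E : ℕ → Set (Pt d)} {Z : Set (Pt d)}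
    (hΩ : ∀ j x v, x + pmul P v ∈ Ω j ↔ x ∈ Ω j) (hE : ∀ j, k₀ < j → ∀ x v, x + pmul P v ∈ E j ↔ x ∈ E j)
    (hZ : ∀ x v, x + pmul P v ∈ Z ↔ x ∈ Z) (j : ℕ) (x v : Pt d) :
    x + pmul P v ∈ omegaPP L M h k₀ R Ω E Z j ↔ x ∈ omegaPP L M h k₀ R Ω E Z j := by
  unfold omegaPP
  split_ifs
  · exact hΩ j x v
  · exact deck_OmegaPP (deck_Zpp hL hM hR hdj hΩ hE hZ j) (hΩ j) hZ x v

/-- The extension by `∅` commutes with the deck translations. [folklore] -/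
private theorem deck_extend {D : ℕ → Set (Pt d)} (hD : ∀ n x v, x + pmul P v ∈ D n ↔ x ∈ D n) (n : ℕ) (x v : Pt d) :
    x + pmul P v ∈ Admissible.extend k D n ↔ x ∈ Admissible.extend k D n := by
  unfold Admissible.extend
  split_ifs
  · exact hD n x v
  · simp

/-- **THE (1.10)–(1.12) CONSTRUCTION COMMUTES WITH THE DECK TRANSLATIONS OF THE TORUS**: if every `Ω_j` and `Z` are
invariant under `x ↦ x + P·v` (sets of the torus `T_η` seen on the cover) and the cube sides in use divide the periods
(`LᵏM ∣ P_μ`; `LʲMR_j ∣ P_μ` for `j ≤ k₀`), then every new domain `Ω″_j` of (1.12), built with the §4 completion of (1.10),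
is invariant too. [cite: Balaban1989LargeFieldI, (1.10)–(1.12) p.179; Balaban1984PropagatorsII, (2.1)–(2.4) p.224] -/
theorem omegaPP_completion_add_pmul (hL : 1 ≤ L) (hM : 1 ≤ M) (hR : ∀ j, 1 ≤ R j) (hdk : ∀ μ, side L M k ∣ P μ)
    (hdj : ∀ j, j ≤ k₀ → ∀ μ, side L M j * R j ∣ P μ) {Ω : ℕ → Set (Pt d)} {Z : Set (Pt d)}
    (hΩ : ∀ j x v, x + pmul P v ∈ Ω j ↔ x ∈ Ω j) (hZ : ∀ x v, x + pmul P v ∈ Z ↔ x ∈ Z) (j : ℕ) (x v : Pt d) :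
    x + pmul P v ∈ omegaPP L M h k₀ R Ω (completion L M k₀ k (Ω (k₀ + 1)) Z) Z j ↔
      x ∈ omegaPP L M h k₀ R Ω (completion L M k₀ k (Ω (k₀ + 1)) Z) Z j :=
  deck_omegaPP hL hM hR hdj hΩ (fun j _ => deck_completion hL hM hdk (hΩ (k₀ + 1)) hZ j) hZ j x v

/-- For a deck-invariant domain the INTERSECTED domain of p29 g13 (`interD`: the points all of whose deck translates lie
in it) is the domain itself — on periodic data §9.3 below is §9.2. [cite: Balaban1984PropagatorsI, Sect. A p.17] -/
theorem interD_eq_self_of_add_pmul {D : ℕ → Set (Pt d)} {n : ℕ} (hD : ∀ x v, x + pmul P v ∈ D n ↔ x ∈ D n) :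
    interD P D n = D n :=
  Set.Subset.antisymm (interD_subset n) fun x hx v => (hD (x - pmul P v) v).1 (by rwa [sub_add_cancel])

end Deck

/-! ### §9.2 Lemma 2.1 with c₁″ on the torus for a periodic admissible sequence, and for THE (1.12) sequence -/

namespace Admissible

variable {L M k : ℕ} {D : ℕ → Set (Pt d)} {P : Fin d → ℕ}

/-- **The periodicity datum of a periodic admissible sequence up to `k`** (extended by `∅` above `k`): p29 g13's
`isPeriodic_of_admissible` BY NAME. [cite: Balaban1984PropagatorsII, (2.1)–(2.4) p.224; Balaban1988Convergent, (2.13) p.256] -/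
theorem isPeriodic_extend (hA : Admissible L M k D) (hD : ∀ n x v, x + pmul P v ∈ D n ↔ x ∈ D n) (hP : ∀ μ, 0 < P μ)
    (hdvdP : ∀ μ, side L M k ∣ P μ) {M₁ : ℕ} (hM₁ : 0 < M₁) (hM : 1 ≤ M) (hdvd : M₁ ∣ M) (hL : 1 ≤ L) :
    IsPeriodic M₁ L (fun n => (extend k D n)ᶜ) P :=
  isPeriodic_of_admissible hA.extend_sep (extend_of_lt (Nat.lt_succ_self k)) (deck_extend hD) hP
    (fun μ => (show M₁ * L ^ k ∣ side L M k by
      unfold side; rw [mul_comm]; exact Nat.mul_dvd_mul_left _ hdvd).trans (hdvdP μ)) hM₁ hM hL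

/-- **[B6] Lemma 2.1 with c₁″ ON THE TORUS for every periodic admissible sequence up to `k` with `D₀ = T_η`** — p29 g12's
`lemma21_full_torGeo_admissible` BY NAME (print's distance (2.46) read literally on the torus, torus-contour geometry on
any finite set of torus bond cubes of the layers `(D_n)ᶜ`, `0 < α < 1`, (2.59)).
[cite: Balaban1984PropagatorsII, Lemma 2.1 (2.60)–(2.63) p.234, (2.1)–(2.4) p.224; Balaban1988Convergent, (2.13) p.256] -/
theorem lemma21_full_torGeo [NeZero d] (hA : Admissible L M k D) (h0 : D 0 = Set.univ)
    (hD : ∀ n x v, x + pmul P v ∈ D n ↔ x ∈ D n) (hP : ∀ μ, 0 < P μ) (hdvdP : ∀ μ, side L M k ∣ P μ) {M₁ : ℕ}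
    (hM₁ : 0 < M₁) (hM : 1 ≤ M) (hdvd : M₁ ∣ M) (hL : 2 ≤ L) (F : Finset (TSite M₁ L (fun n => (extend k D n)ᶜ) P))
    (kk : ℕ) (η R Mr : ℝ) (hRM : R * Mr ≤ ((M / M₁ : ℕ) : ℝ)) (hN : 2 ≤ M / M₁) {δ₀ : ℝ} (hδ : 0 < δ₀) :
    ∀ α : ℝ, 0 < α → α < 1 → B6.Cond259 d δ₀ α R Mr →
      B6RandomWalk.Ineq260
          (torGeo (hA.isPeriodic_extend hD hP hdvdP hM₁ hM hdvd (Nat.le_of_succ_le hL)) F kk η R Mr) δ₀ α ∧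
        B6Lemma21Repaired.Ineq261With (B6Lemma21TwoScale.c1TwoScale d δ₀ α)
          (torGeo (hA.isPeriodic_extend hD hP hdvdP hM₁ hM hdvd (Nat.le_of_succ_le hL)) F kk η R Mr) δ₀ α ∧
        B6Lemma21Repaired.Ineq262With (B6Lemma21TwoScale.c1TwoScale d δ₀ α)
          (torGeo (hA.isPeriodic_extend hD hP hdvdP hM₁ hM hdvd (Nat.le_of_succ_le hL)) F kk η R Mr) δ₀ α ∧
        B6Lemma21Repaired.Ineq263With (B6Lemma21TwoScale.c1TwoScale d δ₀ α)
          (torGeo (hA.isPeriodic_extend hD hP hdvdP hM₁ hM hdvd (Nat.le_of_succ_le hL)) F kk η R Mr) δ₀ α :=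
  lemma21_full_torGeo_admissible hA.extend_sep hA.extend_cubes_all (by rw [extend_of_le (Nat.zero_le k)]; exact h0)
    (extend_of_lt (Nat.lt_succ_self k)) hM₁ hM hdvd hL _ F kk η R Mr hRM hN hδ

end Admissible

namespace Hypotheses

variable {L M h k₀ k : ℕ} {R : ℕ → ℕ} {Ω : ℕ → Set (Pt d)} {Z : Set (Pt d)} {P : Fin d → ℕ}

/-- **The periodicity datum for THE (1.12) sequence** on the cover of the torus of periods `P` (periodic `Ω_j`, `Z`;
`LᵏM ∣ P_μ`, `LʲMR_j ∣ P_μ` for `j ≤ k₀`; bond cubes of side `M₁Lⁿ`, `M₁ ∣ M`).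
[cite: Balaban1989LargeFieldI, (1.12) p.179; Balaban1984PropagatorsII, (2.1)–(2.4) p.224] -/
theorem isPeriodic_omegaPP (H : Hypotheses L M h k₀ k R Ω Z) (hΩ : ∀ j x v, x + pmul P v ∈ Ω j ↔ x ∈ Ω j)
    (hZ : ∀ x v, x + pmul P v ∈ Z ↔ x ∈ Z) (hP : ∀ μ, 0 < P μ) (hdk : ∀ μ, side L M k ∣ P μ)
    (hdj : ∀ j, j ≤ k₀ → ∀ μ, side L M j * R j ∣ P μ) {M₁ : ℕ} (hM₁ : 0 < M₁) (hdvd : M₁ ∣ M) :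
    IsPeriodic M₁ L
      (fun n => (Admissible.extend k (omegaPP L M h k₀ R Ω (completion L M k₀ k (Ω (k₀ + 1)) Z) Z) n)ᶜ) P :=
  H.admissible_omegaPP_completion.isPeriodic_extend
    (omegaPP_completion_add_pmul (Nat.le_of_succ_le H.hL) H.hM H.hR hdk hdj hΩ hZ) hP hdk hM₁ H.hM hdvd
    (Nat.le_of_succ_le H.hL)

/-- For periodic data the intersected (1.12) domains of §9.3 ARE the (1.12) domains (nothing is cut away).
[cite: Balaban1989LargeFieldI, (1.12) p.179; Balaban1984PropagatorsI, Sect. A p.17] -/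
theorem interD_extend_omegaPP_eq (H : Hypotheses L M h k₀ k R Ω Z) (hΩ : ∀ j x v, x + pmul P v ∈ Ω j ↔ x ∈ Ω j)
    (hZ : ∀ x v, x + pmul P v ∈ Z ↔ x ∈ Z) (hdk : ∀ μ, side L M k ∣ P μ)
    (hdj : ∀ j, j ≤ k₀ → ∀ μ, side L M j * R j ∣ P μ) :
    interD P (Admissible.extend k (omegaPP L M h k₀ R Ω (completion L M k₀ k (Ω (k₀ + 1)) Z) Z)) =
      Admissible.extend k (omegaPP L M h k₀ R Ω (completion L M k₀ k (Ω (k₀ + 1)) Z) Z) :=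
  funext fun n => interD_eq_self_of_add_pmul
    (deck_extend (omegaPP_completion_add_pmul (Nat.le_of_succ_le H.hL) H.hM H.hR hdk hdj hΩ hZ) n)

/-- **[B6] Lemma 2.1 (2.60)–(2.63) with c₁″ ON THE TORUS `T_η` FOR THE (1.12) SEQUENCE `{Ω″_j}`** of the 𝐑-operation
(periodic data as above, `Ω₀ = T_η`, the §4 completion of (1.10)): p29 g12's torus Lemma 2.1 — print's distance (2.46) read
literally on the torus — for the torus-contour geometry on any finite set of torus bond cubes of the new large-field layers
`(Ω″_n)ᶜ`. [cite: Balaban1989LargeFieldI, (1.12) p.179, (1.47) p.186; Balaban1984PropagatorsII, Lemma 2.1 p.234, (2.46) p.231] -/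
theorem lemma21_full_torGeo_omegaPP [NeZero d] (H : Hypotheses L M h k₀ k R Ω Z) (hΩ0 : Ω 0 = Set.univ)
    (hΩ : ∀ j x v, x + pmul P v ∈ Ω j ↔ x ∈ Ω j) (hZ : ∀ x v, x + pmul P v ∈ Z ↔ x ∈ Z) (hP : ∀ μ, 0 < P μ)
    (hdk : ∀ μ, side L M k ∣ P μ) (hdj : ∀ j, j ≤ k₀ → ∀ μ, side L M j * R j ∣ P μ) {M₁ : ℕ} (hM₁ : 0 < M₁)
    (hdvd : M₁ ∣ M)
    (F : Finset (TSite M₁ L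
      (fun n => (Admissible.extend k (omegaPP L M h k₀ R Ω (completion L M k₀ k (Ω (k₀ + 1)) Z) Z) n)ᶜ) P))
    (kk : ℕ) (η Rr Mr : ℝ) (hRM : Rr * Mr ≤ ((M / M₁ : ℕ) : ℝ)) (hN : 2 ≤ M / M₁) {δ₀ : ℝ} (hδ : 0 < δ₀) :
    ∀ α : ℝ, 0 < α → α < 1 → B6.Cond259 d δ₀ α Rr Mr →
      B6RandomWalk.Ineq260 (torGeo (H.isPeriodic_omegaPP hΩ hZ hP hdk hdj hM₁ hdvd) F kk η Rr Mr) δ₀ α ∧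
        B6Lemma21Repaired.Ineq261With (B6Lemma21TwoScale.c1TwoScale d δ₀ α)
          (torGeo (H.isPeriodic_omegaPP hΩ hZ hP hdk hdj hM₁ hdvd) F kk η Rr Mr) δ₀ α ∧
        B6Lemma21Repaired.Ineq262With (B6Lemma21TwoScale.c1TwoScale d δ₀ α)
          (torGeo (H.isPeriodic_omegaPP hΩ hZ hP hdk hdj hM₁ hdvd) F kk η Rr Mr) δ₀ α ∧
        B6Lemma21Repaired.Ineq263With (B6Lemma21TwoScale.c1TwoScale d δ₀ α)
          (torGeo (H.isPeriodic_omegaPP hΩ hZ hP hdk hdj hM₁ hdvd) F kk η Rr Mr) δ₀ α :=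
  H.admissible_omegaPP_completion.lemma21_full_torGeo (omegaPP_zero hΩ0)
    (omegaPP_completion_add_pmul (Nat.le_of_succ_le H.hL) H.hM H.hR hdk hdj hΩ hZ) hP hdk hM₁ H.hM hdvd H.hL F kk η
    Rr Mr hRM hN hδ

end Hypotheses

/-! ### §9.3 Arbitrary cover data: the same for the INTERSECTED (1.12) domains (p29 g13's faithful transfer BY NAME) -/

namespace Admissible

variable {L M k : ℕ} {D : ℕ → Set (Pt d)} {P : Fin d → ℕ}

/-- The periodicity datum of the intersected extension of any admissible sequence up to `k` (g13's `isPeriodic_interD`).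
[cite: Balaban1984PropagatorsI, Sect. A p.17; Balaban1988Convergent, (2.13) p.256] -/
theorem isPeriodic_interD_extend (hA : Admissible L M k D) (hP : ∀ μ, 0 < P μ) (hdvdP : ∀ μ, side L M k ∣ P μ)
    {M₁ : ℕ} (hM₁ : 0 < M₁) (hM : 1 ≤ M) (hdvd : M₁ ∣ M) (hL : 1 ≤ L) :
    IsPeriodic M₁ L (fun n => (interD P (extend k D) n)ᶜ) P :=
  isPeriodic_interD hA.extend_sep (extend_of_lt (Nat.lt_succ_self k)) hP hdvdP hM₁ hM hdvd hL

/-- **[B6] Lemma 2.1 with c₁″ on the torus for the INTERSECTED domains of ANY admissible sequence up to `k` with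
`D₀ = T_η`** (the large fields of all period cells drawn on one torus) — g13's `lemma21_full_torGeo_interD` BY NAME; for
deck-invariant `D` this is `lemma21_full_torGeo` (`interD_eq_self_of_add_pmul`).
[cite: Balaban1984PropagatorsII, Lemma 2.1 (2.60)–(2.63) p.234; Balaban1984PropagatorsI, Sect. A p.17; Balaban1988Convergent, (2.13) p.256] -/
theorem lemma21_full_torGeo_interD [NeZero d] (hA : Admissible L M k D) (h0 : D 0 = Set.univ) (hP : ∀ μ, 0 < P μ)
    (hdvdP : ∀ μ, side L M k ∣ P μ) {M₁ : ℕ} (hM₁ : 0 < M₁) (hM : 1 ≤ M) (hdvd : M₁ ∣ M) (hL : 2 ≤ L)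
    (F : Finset (TSite M₁ L (fun n => (interD P (extend k D) n)ᶜ) P)) (kk : ℕ) (η R Mr : ℝ)
    (hRM : R * Mr ≤ ((M / M₁ : ℕ) : ℝ)) (hN : 2 ≤ M / M₁) {δ₀ : ℝ} (hδ : 0 < δ₀) :
    ∀ α : ℝ, 0 < α → α < 1 → B6.Cond259 d δ₀ α R Mr →
      B6RandomWalk.Ineq260
          (torGeo (hA.isPeriodic_interD_extend hP hdvdP hM₁ hM hdvd (Nat.le_of_succ_le hL)) F kk η R Mr) δ₀ α ∧
        B6Lemma21Repaired.Ineq261With (B6Lemma21TwoScale.c1TwoScale d δ₀ α)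
          (torGeo (hA.isPeriodic_interD_extend hP hdvdP hM₁ hM hdvd (Nat.le_of_succ_le hL)) F kk η R Mr) δ₀ α ∧
        B6Lemma21Repaired.Ineq262With (B6Lemma21TwoScale.c1TwoScale d δ₀ α)
          (torGeo (hA.isPeriodic_interD_extend hP hdvdP hM₁ hM hdvd (Nat.le_of_succ_le hL)) F kk η R Mr) δ₀ α ∧
        B6Lemma21Repaired.Ineq263With (B6Lemma21TwoScale.c1TwoScale d δ₀ α)
          (torGeo (hA.isPeriodic_interD_extend hP hdvdP hM₁ hM hdvd (Nat.le_of_succ_le hL)) F kk η R Mr) δ₀ α :=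
  B15LatticeCubeTorusNestedBoxes.lemma21_full_torGeo_interD hA.extend_sep hA.extend_cubes_all
    (by rw [extend_of_le (Nat.zero_le k)]; exact h0) (extend_of_lt (Nat.lt_succ_self k)) hP hdvdP hM₁ hM hdvd hL F kk
    η R Mr hRM hN hδ

end Admissible

/-! ### §9.4 A periodic `d = 1` instance: the hypotheses of §9.2 are jointly satisfiable (with `Z ≠ ∅`) -/

section InstanceP

/-- The old domains of the PERIODIC instance (period `1600`; `L = 2`, `M = 1`, `h = 0`, `k₀ = 1`, `k = 3`): `Ω₀ = Ω₁ = ℤ`,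
`Ω₂ = {x mod 1600 < 8} ∪ {x mod 1600 ≥ 792}`, `Ω₃ = {x mod 1600 ≥ 800}` (and `Ω_j = Ω₃` above). [folklore] -/
private def ΩinstP (j : ℕ) : Set (Pt 1) :=
  if j ≤ 1 then Set.univ else if j = 2 then {x | x 0 % 1600 < 8 ∨ 792 ≤ x 0 % 1600} else {x | 800 ≤ x 0 % 1600}

/-- The periodic `Z = {x mod 1600 < 800} = Ω₃ᶜ` (one component `[0, 800)` per period cell). [folklore] -/
private def ZinstP : Set (Pt 1) := {x | x 0 % 1600 < 800}

/-- The period `P = 1600`. [folklore] -/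
private def Pinst : Fin 1 → ℕ := fun _ => 1600

/-- **Non-vacuity of §9.2**: `Hypotheses` for the periodic `d = 1` data, `Z ≠ ∅`, `Ω₀ = ℤ`, every `Ω_j` and `Z` invariant
under the deck translations `x ↦ x + 1600·v`, and the divisibilities `L³M = 8 ∣ 1600`, `LʲMR_j ∣ 1600` (`j ≤ 1`).
[cite: Balaban1989LargeFieldI, (1.10)–(1.12) p.179; Balaban1984PropagatorsII, (2.1)–(2.4) p.224] -/
theorem hypotheses_instance_periodic :
    Hypotheses 2 1 0 1 3 Rinst ΩinstP ZinstP ∧ ZinstP.Nonempty ∧ ΩinstP 0 = Set.univ ∧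
      (∀ (j : ℕ) (x v : Pt 1), x + pmul Pinst v ∈ ΩinstP j ↔ x ∈ ΩinstP j) ∧
      (∀ x v : Pt 1, x + pmul Pinst v ∈ ZinstP ↔ x ∈ ZinstP) ∧ (∀ μ, 0 < Pinst μ) ∧ (∀ μ, side 2 1 3 ∣ Pinst μ) ∧
      (∀ j, j ≤ 1 → ∀ μ, side 2 1 j * Rinst j ∣ Pinst μ) := by
  refine ⟨⟨le_rfl, le_rfl, fun j => by unfold Rinst; split_ifs <;> omega, by norm_num, by norm_num,
    by simp [side, Rinst], ⟨?_, ?_⟩, ?_, ⟨?_, ?_⟩⟩, ⟨pt1 0, by simp [ZinstP, pt1]⟩, by simp [ΩinstP], ?_, ?_,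
    fun μ => by simp [Pinst], fun μ => by simp [Pinst, side], ?_⟩
  · -- cubes of `Ω_j`
    intro j hj x y hxy
    rw [cubeIdx_eq_iff] at hxy
    unfold ΩinstP
    interval_cases j <;> simp [side] at hxy ⊢ <;> omega
  · -- separation of `Ω_j`
    intro j hj x hx y hy
    have hy0 := abs_le.mp (hy 0)
    unfold ΩinstP at hx ⊢
    interval_cases j <;> simp [side] at hx hy0 ⊢
    omega
  · -- margin: `Ω₀ = Ω₁ = ℤ`
    intro j hj hj1 x _
    unfold ΩinstP
    interval_cases j <;> simp
  · -- `Z` is a union of `8`-cubes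
    intro x y hxy
    rw [cubeIdx_eq_iff] at hxy
    simp only [side, Rinst] at hxy
    norm_num at hxy
    simp only [ZinstP, Set.mem_setOf_eq]
    omega
  · -- closedness: `Ω₃ᶜ = Z`
    intro x y _ hx _
    simp only [ΩinstP, ZinstP, Set.mem_setOf_eq] at hx ⊢
    norm_num at hx
    omega
  · -- every `Ω_j` is invariant under `x ↦ x + 1600·v`
    intro j x v
    unfold ΩinstP
    split_ifs <;> simp [pmul, Pinst, Int.add_mul_emod_self_left]
  · -- `Z` is invariant
    intro x v
    simp [ZinstP, pmul, Pinst, Int.add_mul_emod_self_left]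
  · -- `LʲMR_j ∣ 1600` for `j ≤ 1`
    intro j hj μ
    interval_cases j <;> simp [side, Rinst, Pinst]

end InstanceP

end Torus

end Literature.MathematicalPhysics.QuantumFieldTheory.Balaban1983to89.B15Eq112Admissible
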